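import Literature.AlgebraicTopology.FundamentalGroup.VanKampenPushout
import HarnessLib

/-!
# Seifert–van Kampen for two open sets meeting in two components (HNN form)

Topic `Literature/AlgebraicTopology/FundamentalGroup`; a complement to `VanKampenPushout.lean`
(two open sets with *path-connected* intersection).  This file **proves** the Seifert–van
Kampen theorem for a cover `Y = U ∪ T` by two path-connected open sets whose intersection
`U ∩ T = C₁ ⊔ C₂` is the disjoint union of **two** path-connected open pieces — the situation
of a space cut along a *non-separating* two-sided hypersurface (`T` a product neighbourhood of
the hypersurface, `U` the complement of the hypersurface, `C₁`, `C₂` the two sides of the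
collar), of a `1`-handle `T` attached to `U` along two discs, or of a mapping torus.  It is the
one-vertex-one-loop case of the van Kampen theorem for fundamental groupoids on two base points
(R. Brown, *Topology and Groupoids* (2006), 6.7.2 and §9.1; Hatcher, *Algebraic Topology*
(2002), §1.2, Thm. 1.20 for the method and §1.B (graphs of groups) for the shape of the answer:
an amalgam over `C₁` combined with an HNN extension over `C₂`).

Fix base points `x₀ ∈ C₁`, `c₂ ∈ C₂` and paths `η_U ⊆ U`, `η_T ⊆ T` from `x₀` to `c₂`; the
**stable loop** is `t = η_U · η_T⁻¹`, a loop at `x₀` crossing the "hypersurface" once.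

* **Universal property** (`HNNData.lift`, `HNNData.lift_inclHom_U`, `HNNData.lift_inclHom_T`,
  `HNNData.lift_stableClass`, `HNNData.hom_ext`, `HNNData.lift_unique`,
  `HNNData.existsUnique_hom`): for a group `G`, homomorphisms `φ_U : π₁(U, x₀) → G`,
  `φ_T : π₁(T, x₀) → G` and an element `τ ∈ G` such that
  (1) `φ_U [δ] = φ_T [δ]` for loops `δ` at `x₀` inside `C₁`, and
  (2) `φ_U [η_U δ η_U⁻¹] = τ⁻¹ · φ_T [η_T δ η_T⁻¹] · τ` for loops `δ` at `c₂` inside `C₂`,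
  there is a unique homomorphism `Φ : π₁(Y, x₀) → G` with `Φ ∘ (i_U)_* = φ_U`,
  `Φ ∘ (i_T)_* = φ_T` and `Φ [t] = τ`.  (With Mathlib's `FundamentalGroup.mul_def`, products of
  classes are reversed concatenations, whence the shape of (2).)
* **Generation** (`HNNData.closure_gens_eq_top`): `π₁(Y, x₀)` is generated by the images of
  `π₁(U, x₀)`, `π₁(T, x₀)` and the class of the stable loop.
* **Free product with `ℤ`** (`fundamentalGroupEquivCoprodInt` and its `simp` lemmas): if `T`,
  `C₁` and `C₂` are simply connected — e.g. `T ≅ Sⁿ × (-1, 1)`, `n ≥ 2`, a product neighbourhood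
  of a non-separating sphere, `C₁`, `C₂` the two half-collars — then
  `π₁(Y, x₀) ≅ π₁(U, x₀) ∗ ℤ`, the generator of `ℤ` being the stable loop: the fundamental
  group of a manifold cut open along a non-separating sphere loses a free factor `ℤ` (Hempel,
  *3-Manifolds* (1976), Lemma 3.8 with p. 26: `π₁(M₁ # M₂) = π₁(M₁) ∗ π₁(M₂)`, `M₂` an
  `S²`-bundle over `S¹`).

## Proof

The label calculus of `VanKampenPushout.lean` (Hatcher's proof of Thm. 1.20 without reduced
words: a homomorphism is *constructed* by multiplying labels of the edges of a fine subdivision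
and shown well defined by the grid argument of `VanKampenKernel.lean`), with two changes.

* **Two systems of connecting paths.**  A point `y ∈ C₂` is joined to `x₀` inside `U` by
  `η_U · a_y` and inside `T` by `η_T · a_y`, where `a_y ⊆ C₂` joins `c₂` to `y`; every other
  point has one connecting path as before (inside `C₁`, `U` or `T`).  Each piece `P ∈ {U, T}`
  thus has its own loops `conn_P(y) · E · conn_P(y')⁻¹` attached to a path `E ⊆ P`.
* **Gauged labels.**  The label of a path `E ⊆ P` from `y` to `y'` is
  `g_P(y')⁻¹ · φ_P [conn_P(y) · E · conn_P(y')⁻¹] · g_P(y)` with the *gauge* `g_T(y) = τ` for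
  `y ∈ C₂` and `g = 1` otherwise.  Gauged labels are still multiplicative along concatenations
  inside a piece and invariant under homotopies inside a piece, and — the point of conditions
  (1), (2) — a path inside `U ∩ T` (hence inside `C₁` or inside `C₂`, being connected) has the
  same `U`-label and `T`-label (`HNNData.glab_pieceU_eq_glab_pieceT`).  From here on the proof
  of `VanKampenPushout.lean` goes through word for word: refinement invariance, homotopy
  invariance by the grid lemma, multiplicativity, the homomorphism `Φ`, its values on `π₁(U)`,
  `π₁(T)` (the gauge is `1` at `x₀`) and on the stable loop (`= τ`, a two-edge computation), and
  generation (every loop is the product of the loops `conn_U · E|[tⱼ, tⱼ₊₁] · conn_U⁻¹`, each of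
  which is a loop of `U`, or a loop of `T` conjugated by `conn_U · conn_T⁻¹ ∈ {1, t}`).

## References

* R. Brown, *Topology and Groupoids*, BookSurge (2006), 6.7.2 (van Kampen for the fundamental
  groupoid on a set of base points), §9.1. [Brown2006]
* A. Hatcher, *Algebraic Topology*, Cambridge Univ. Press (2002), §1.2 Thm. 1.20 and its proof,
  §1.B (graphs of groups, HNN extensions). [HatcherAT2002]
* J. Hempel, *3-Manifolds*, Ann. of Math. Studies 86 (1976), Lemma 3.8, p. 26. [Hempel1976]
-/

noncomputable section

open Set Function unitInterval Topology

namespace Literature.AlgebraicTopology.FundamentalGroup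

namespace VanKampen

variable {Y : Type*} [TopologicalSpace Y] {G : Type*} [Group G]

/-! ### The datum -/

variable (Y G) in
/-- **The datum of the two-component Seifert–van Kampen theorem**: an open cover `Y = U ∪ T` by
path-connected sets with `U ∩ T = C₁ ⊔ C₂` (two disjoint open path-connected pieces), base
points `x₀ ∈ C₁`, `c₂ ∈ C₂`, paths `η_U ⊆ U`, `η_T ⊆ T` from `x₀` to `c₂`, and a *cone*: a
group `G`, homomorphisms `φ_U : π₁(U, x₀) → G`, `φ_T : π₁(T, x₀) → G` and `τ ∈ G` (the value on
the stable loop `η_U · η_T⁻¹`) such that `φ_U`, `φ_T` agree on loops inside `C₁` and agree up to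
conjugation by `τ` on loops inside `C₂` transported to `x₀` along `η_U`, `η_T` (Brown 2006,
6.7.2 on the base points `{x₀, c₂}`; Hatcher 2002, §1.B). [cite: HatcherAT2002, Thm. 1.20 and §1.B] -/
structure HNNData where
  /-- The first open piece. -/
  U : Set Y
  /-- The second open piece. -/
  T : Set Y
  /-- `U` is open. -/
  hUo : IsOpen U
  /-- `T` is open. -/
  hTo : IsOpen T
  /-- The two pieces cover. -/
  hcov : U ∪ T = univ
  /-- The first component of `U ∩ T`. -/
  C₁ : Set Y
  /-- The second component of `U ∩ T`. -/
  C₂ : Set Y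
  /-- `C₁` is open. -/
  hC₁o : IsOpen C₁
  /-- `C₂` is open. -/
  hC₂o : IsOpen C₂
  /-- The two components are disjoint. -/
  hdisj : Disjoint C₁ C₂
  /-- `U ∩ T = C₁ ∪ C₂`. -/
  hinter : U ∩ T = C₁ ∪ C₂
  /-- The base point. -/
  x₀ : Y
  /-- The base point lies in `C₁`. -/
  hx₀ : x₀ ∈ C₁
  /-- The base point lies in `U`. -/
  hxU : x₀ ∈ U
  /-- The base point lies in `T`. -/
  hxT : x₀ ∈ T
  /-- The auxiliary base point of the second component. -/
  c₂ : Y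
  /-- The auxiliary base point lies in `C₂`. -/
  hc₂ : c₂ ∈ C₂
  /-- `U` is path connected. -/
  hUpc : IsPathConnected U
  /-- `T` is path connected. -/
  hTpc : IsPathConnected T
  /-- `C₁` is path connected. -/
  hC₁pc : IsPathConnected C₁
  /-- `C₂` is path connected. -/
  hC₂pc : IsPathConnected C₂
  /-- The path from `x₀` to `c₂` inside `U`. -/
  ηU : Path x₀ c₂
  /-- `η_U` runs in `U`. -/
  ηU_mem : ∀ t, ηU t ∈ U
  /-- The path from `x₀` to `c₂` inside `T`. -/
  ηT : Path x₀ c₂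
  /-- `η_T` runs in `T`. -/
  ηT_mem : ∀ t, ηT t ∈ T
  /-- The homomorphism on `π₁(U, x₀)`. -/
  φU : _root_.FundamentalGroup U ⟨x₀, hxU⟩ →* G
  /-- The homomorphism on `π₁(T, x₀)`. -/
  φT : _root_.FundamentalGroup T ⟨x₀, hxT⟩ →* G
  /-- The value on the stable loop `η_U · η_T⁻¹`. -/
  τ : G
  /-- `φ_U` and `φ_T` agree on the loops at `x₀` inside `C₁`. -/
  compat₁ : ∀ (δ : Path x₀ x₀) (hU : ∀ t, δ t ∈ U) (hT : ∀ t, δ t ∈ T), (∀ t, δ t ∈ C₁) →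
    φU (_root_.FundamentalGroup.fromPath (Path.Homotopic.Quotient.mk (liftPath U δ hU))) =
      φT (_root_.FundamentalGroup.fromPath (Path.Homotopic.Quotient.mk (liftPath T δ hT)))
  /-- `φ_U` and `φ_T` agree up to `τ`-conjugation on the loops at `c₂` inside `C₂`, transported
  to `x₀` along `η_U`, `η_T`. -/
  compat₂ : ∀ (δ : Path c₂ c₂), (∀ t, δ t ∈ C₂) →
    ∀ (hU : ∀ t, (ηU.trans (δ.trans ηU.symm)) t ∈ U)
      (hT : ∀ t, (ηT.trans (δ.trans ηT.symm)) t ∈ T),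
    φU (_root_.FundamentalGroup.fromPath (Path.Homotopic.Quotient.mk
        (liftPath U (ηU.trans (δ.trans ηU.symm)) hU))) =
      τ⁻¹ * φT (_root_.FundamentalGroup.fromPath (Path.Homotopic.Quotient.mk
        (liftPath T (ηT.trans (δ.trans ηT.symm)) hT))) * τ

namespace HNNData

variable (Δ : HNNData Y G)

/-! ### Membership bookkeeping -/

/-- Every point of `Y` lies in `U` or in `T`. [folklore] -/
theorem mem_or_mem (y : Y) : y ∈ Δ.U ∨ y ∈ Δ.T := by
  have : y ∈ Δ.U ∪ Δ.T := by rw [Δ.hcov]; exact mem_univ y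
  exact this

/-- `C₁ ⊆ U`. [folklore] -/
theorem C₁_subset_U : Δ.C₁ ⊆ Δ.U := fun _ h => (Δ.hinter.symm.subset (Or.inl h)).1

/-- `C₁ ⊆ T`. [folklore] -/
theorem C₁_subset_T : Δ.C₁ ⊆ Δ.T := fun _ h => (Δ.hinter.symm.subset (Or.inl h)).2

/-- `C₂ ⊆ U`. [folklore] -/
theorem C₂_subset_U : Δ.C₂ ⊆ Δ.U := fun _ h => (Δ.hinter.symm.subset (Or.inr h)).1

/-- `C₂ ⊆ T`. [folklore] -/
theorem C₂_subset_T : Δ.C₂ ⊆ Δ.T := fun _ h => (Δ.hinter.symm.subset (Or.inr h)).2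

/-- A point of `U ∩ T` lies in `C₁` or in `C₂`. [folklore] -/
theorem mem_C₁_or_C₂ {y : Y} (hU : y ∈ Δ.U) (hT : y ∈ Δ.T) : y ∈ Δ.C₁ ∨ y ∈ Δ.C₂ :=
  Δ.hinter.subset ⟨hU, hT⟩

/-- Points of `C₁` are not in `C₂`. [folklore] -/
theorem not_mem_C₂_of_mem_C₁ {y : Y} (h : y ∈ Δ.C₁) : y ∉ Δ.C₂ :=
  fun h' => Set.disjoint_left.1 Δ.hdisj h h'

/-- The base point is not in `C₂`. [folklore] -/
theorem x₀_not_mem_C₂ : Δ.x₀ ∉ Δ.C₂ := Δ.not_mem_C₂_of_mem_C₁ Δ.hx₀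

/-- A path inside `U ∩ T` runs inside `C₁` or inside `C₂` (its range is connected and `C₁`,
`C₂` are disjoint open sets covering `U ∩ T`). [folklore] -/
theorem forall_mem_C₁_or_C₂ {y y' : Y} (E : Path y y') (hU : ∀ t, E t ∈ Δ.U)
    (hT : ∀ t, E t ∈ Δ.T) : (∀ t, E t ∈ Δ.C₁) ∨ (∀ t, E t ∈ Δ.C₂) := by
  have hsub : range E ⊆ Δ.C₁ ∪ Δ.C₂ := by
    rintro _ ⟨t, rfl⟩
    exact Δ.mem_C₁_or_C₂ (hU t) (hT t)
  rcases (isPreconnected_range E.continuous).subset_or_subset Δ.hC₁o Δ.hC₂o Δ.hdisj hsub with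
    h | h
  · exact Or.inl fun t => h (mem_range_self t)
  · exact Or.inr fun t => h (mem_range_self t)

/-! ### Connecting paths -/

open Classical in
/-- Connecting path from the base point to a point `y ∉ C₂`: constant if `y = x₀`, inside `C₁`
if `y ∈ C₁`, inside `U` if `y ∈ U ∖ T`, inside `T` otherwise (Hatcher's paths `g_v`).
[cite: HatcherAT2002, proof of Thm. 1.20] -/
def conn (y : Y) : Path Δ.x₀ y :=
  if h₀ : y = Δ.x₀ then (Path.refl Δ.x₀).cast rfl h₀
  else if h₁ : y ∈ Δ.C₁ then (Δ.hC₁pc.joinedIn Δ.x₀ Δ.hx₀ y h₁).somePath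
  else if h₂ : y ∈ Δ.U then (Δ.hUpc.joinedIn Δ.x₀ Δ.hxU y h₂).somePath
  else (Δ.hTpc.joinedIn Δ.x₀ Δ.hxT y ((Δ.mem_or_mem y).resolve_left h₂)).somePath

/-- The connecting path of the base point is constant. [folklore] -/
theorem conn_self : Δ.conn Δ.x₀ = Path.refl Δ.x₀ := by
  unfold conn
  rw [dif_pos rfl]
  rfl

/-- Connecting paths to points of `C₁` run in `C₁`. [folklore] -/
theorem conn_mem_C₁ {y : Y} (hy : y ∈ Δ.C₁) (t : I) : Δ.conn y t ∈ Δ.C₁ := by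
  unfold conn
  split_ifs with h₀
  · subst h₀; exact Δ.hx₀
  · exact (Δ.hC₁pc.joinedIn Δ.x₀ Δ.hx₀ y hy).somePath_mem t

/-- Connecting paths to points of `U` run in `U`. [folklore] -/
theorem conn_mem_U {y : Y} (hy : y ∈ Δ.U) (t : I) : Δ.conn y t ∈ Δ.U := by
  unfold conn
  split_ifs with h₀ h₁
  · subst h₀; exact Δ.hxU
  · exact Δ.C₁_subset_U ((Δ.hC₁pc.joinedIn Δ.x₀ Δ.hx₀ y h₁).somePath_mem t)
  · exact (Δ.hUpc.joinedIn Δ.x₀ Δ.hxU y hy).somePath_mem t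

/-- Connecting paths to points of `T ∖ C₂` run in `T`. [folklore] -/
theorem conn_mem_T {y : Y} (hy : y ∈ Δ.T) (hy₂ : y ∉ Δ.C₂) (t : I) : Δ.conn y t ∈ Δ.T := by
  unfold conn
  split_ifs with h₀ h₁ h₂
  · subst h₀; exact Δ.hxT
  · exact Δ.C₁_subset_T ((Δ.hC₁pc.joinedIn Δ.x₀ Δ.hx₀ y h₁).somePath_mem t)
  · exact absurd (Δ.mem_C₁_or_C₂ h₂ hy) (not_or.2 ⟨h₁, hy₂⟩)
  · exact (Δ.hTpc.joinedIn Δ.x₀ Δ.hxT y ((Δ.mem_or_mem y).resolve_left h₂)).somePath_mem t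

open Classical in
/-- Arc inside `C₂` from `c₂` to a point of `C₂` (constant if the point is `c₂`). [folklore] -/
def arc (y : Y) (hy : y ∈ Δ.C₂) : Path Δ.c₂ y :=
  if h : y = Δ.c₂ then (Path.refl Δ.c₂).cast rfl h
  else (Δ.hC₂pc.joinedIn Δ.c₂ Δ.hc₂ y hy).somePath

/-- The arc of `c₂` is constant. [folklore] -/
theorem arc_self : Δ.arc Δ.c₂ Δ.hc₂ = Path.refl Δ.c₂ := by
  unfold arc
  rw [dif_pos rfl]
  rfl

/-- Arcs run in `C₂`. [folklore] -/
theorem arc_mem {y : Y} (hy : y ∈ Δ.C₂) (t : I) : Δ.arc y hy t ∈ Δ.C₂ := by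
  unfold arc
  split_ifs with h
  · subst h; exact Δ.hc₂
  · exact (Δ.hC₂pc.joinedIn Δ.c₂ Δ.hc₂ y hy).somePath_mem t

open Classical in
/-- **Connecting paths for the piece `U`**: `η_U · a_y` for `y ∈ C₂`, `conn y` otherwise.
[cite: HatcherAT2002, proof of Thm. 1.20] -/
def connU (y : Y) : Path Δ.x₀ y :=
  if h : y ∈ Δ.C₂ then Δ.ηU.trans (Δ.arc y h) else Δ.conn y

open Classical in
/-- **Connecting paths for the piece `T`**: `η_T · a_y` for `y ∈ C₂`, `conn y` otherwise.
[cite: HatcherAT2002, proof of Thm. 1.20] -/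
def connT (y : Y) : Path Δ.x₀ y :=
  if h : y ∈ Δ.C₂ then Δ.ηT.trans (Δ.arc y h) else Δ.conn y

/-- `conn_U` at a point of `C₂`. [folklore] -/
theorem connU_of_mem {y : Y} (h : y ∈ Δ.C₂) : Δ.connU y = Δ.ηU.trans (Δ.arc y h) := by
  unfold connU; rw [dif_pos h]

/-- `conn_U` off `C₂`. [folklore] -/
theorem connU_of_not_mem {y : Y} (h : y ∉ Δ.C₂) : Δ.connU y = Δ.conn y := by
  unfold connU; rw [dif_neg h]

/-- `conn_T` at a point of `C₂`. [folklore] -/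
theorem connT_of_mem {y : Y} (h : y ∈ Δ.C₂) : Δ.connT y = Δ.ηT.trans (Δ.arc y h) := by
  unfold connT; rw [dif_pos h]

/-- `conn_T` off `C₂`. [folklore] -/
theorem connT_of_not_mem {y : Y} (h : y ∉ Δ.C₂) : Δ.connT y = Δ.conn y := by
  unfold connT; rw [dif_neg h]

/-- `conn_U` of the base point is constant. [folklore] -/
theorem connU_self : Δ.connU Δ.x₀ = Path.refl Δ.x₀ := by
  rw [Δ.connU_of_not_mem Δ.x₀_not_mem_C₂, Δ.conn_self]

/-- `conn_T` of the base point is constant. [folklore] -/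
theorem connT_self : Δ.connT Δ.x₀ = Path.refl Δ.x₀ := by
  rw [Δ.connT_of_not_mem Δ.x₀_not_mem_C₂, Δ.conn_self]

/-- `conn_U` of a point of `U` runs in `U`. [folklore] -/
theorem connU_mem {y : Y} (hy : y ∈ Δ.U) (t : I) : Δ.connU y t ∈ Δ.U := by
  by_cases h : y ∈ Δ.C₂
  · rw [Δ.connU_of_mem h]
    exact trans_mem Δ.ηU_mem (fun s => Δ.C₂_subset_U (Δ.arc_mem h s)) t
  · rw [Δ.connU_of_not_mem h]
    exact Δ.conn_mem_U hy t

/-- `conn_T` of a point of `T` runs in `T`. [folklore] -/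
theorem connT_mem {y : Y} (hy : y ∈ Δ.T) (t : I) : Δ.connT y t ∈ Δ.T := by
  by_cases h : y ∈ Δ.C₂
  · rw [Δ.connT_of_mem h]
    exact trans_mem Δ.ηT_mem (fun s => Δ.C₂_subset_T (Δ.arc_mem h s)) t
  · rw [Δ.connT_of_not_mem h]
    exact Δ.conn_mem_T hy h t

/-! ### Pieces, loops and labels -/

/-- One of the two pieces together with its homomorphism, its own system of connecting paths
and its gauge: a subset `S ∋ x₀`, a homomorphism `π₁(S, x₀) → G`, connecting paths from `x₀`
which stay in `S` for points of `S` and are constant at `x₀`, and a function `g : Y → G` with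
`g x₀ = 1`.  The label calculus is developed once for a piece and applied to `U` and `T`.
[folklore] -/
structure Piece where
  /-- The underlying set. -/
  S : Set Y
  /-- The base point lies in the piece. -/
  mem : Δ.x₀ ∈ S
  /-- The homomorphism on the fundamental group of the piece. -/
  φ : _root_.FundamentalGroup S ⟨Δ.x₀, mem⟩ →* G
  /-- The connecting paths of the piece. -/
  conn : ∀ y : Y, Path Δ.x₀ y
  /-- Connecting paths to points of the piece stay in the piece. -/
  conn_mem : ∀ {y : Y}, y ∈ S → ∀ t, conn y t ∈ S
  /-- The connecting path of the base point is constant. -/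
  conn_self : conn Δ.x₀ = Path.refl Δ.x₀
  /-- The gauge. -/
  gauge : Y → G
  /-- The gauge of the base point is trivial. -/
  gauge_self : gauge Δ.x₀ = 1

/-- The piece `U` (trivial gauge). [folklore] -/
def pieceU : Δ.Piece where
  S := Δ.U
  mem := Δ.hxU
  φ := Δ.φU
  conn := Δ.connU
  conn_mem := fun hy => Δ.connU_mem hy
  conn_self := Δ.connU_self
  gauge := fun _ => 1
  gauge_self := rfl

open Classical in
/-- The piece `T` (gauge `τ` on `C₂`). [folklore] -/
def pieceT : Δ.Piece where
  S := Δ.T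
  mem := Δ.hxT
  φ := Δ.φT
  conn := Δ.connT
  conn_mem := fun hy => Δ.connT_mem hy
  conn_self := Δ.connT_self
  gauge := fun y => if y ∈ Δ.C₂ then Δ.τ else 1
  gauge_self := if_neg Δ.x₀_not_mem_C₂

/-- The gauge of `U` is trivial. [folklore] -/
@[simp] theorem pieceU_gauge (y : Y) : Δ.pieceU.gauge y = 1 := rfl

open Classical in
/-- The gauge of `T`. [folklore] -/
theorem pieceT_gauge (y : Y) : Δ.pieceT.gauge y = if y ∈ Δ.C₂ then Δ.τ else 1 := rfl

/-- The gauge of `T` on `C₂` is `τ`. [folklore] -/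
theorem pieceT_gauge_of_mem {y : Y} (h : y ∈ Δ.C₂) : Δ.pieceT.gauge y = Δ.τ := by
  rw [pieceT_gauge, if_pos h]

/-- The gauge of `T` off `C₂` is `1`. [folklore] -/
theorem pieceT_gauge_of_not_mem {y : Y} (h : y ∉ Δ.C₂) : Δ.pieceT.gauge y = 1 := by
  rw [pieceT_gauge, if_neg h]

namespace Piece

variable {Δ} (Pc : Δ.Piece)

/-- The base point of the subspace `S`. [folklore] -/
abbrev z₀ : Pc.S := ⟨Δ.x₀, Pc.mem⟩

/-- The loop `conn_P(y) · E · conn_P(y')⁻¹` at the base point attached to a path `E` of `Y`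
(Hatcher's factorisation device, proof of Thm. 1.20). [cite: HatcherAT2002, proof of Thm. 1.20] -/
def loop {y y' : Y} (E : Path y y') : Path Δ.x₀ Δ.x₀ :=
  (Pc.conn y).trans (E.trans (Pc.conn y').symm)

/-- The loop of a path inside the piece runs in the piece. [folklore] -/
theorem loop_mem {y y' : Y} (E : Path y y') (hE : ∀ t, E t ∈ Pc.S) (t : I) :
    Pc.loop E t ∈ Pc.S := by
  have hy : y ∈ Pc.S := E.source ▸ hE 0
  have hy' : y' ∈ Pc.S := E.target ▸ hE 1
  exact trans_mem (Pc.conn_mem hy) (trans_mem hE (symm_mem (Pc.conn_mem hy'))) t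

/-- The image under `φ` of the class of a loop of the subspace `S` at the base point.
[folklore] -/
abbrev cls (δ : Path Pc.z₀ Pc.z₀) : G :=
  Pc.φ (_root_.FundamentalGroup.fromPath (Path.Homotopic.Quotient.mk δ))

/-- Loops with the same class have the same `cls`. [folklore] -/
theorem cls_eq_of_mk_eq {δ δ' : Path Pc.z₀ Pc.z₀}
    (h : (Path.Homotopic.Quotient.mk δ) = Path.Homotopic.Quotient.mk δ') :
    Pc.cls δ = Pc.cls δ' := by
  change Pc.φ _ = Pc.φ _
  rw [h]

/-- Homotopic loops have the same `cls`. [folklore] -/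
theorem cls_congr {δ δ' : Path Pc.z₀ Pc.z₀} (h : δ.Homotopic δ') : Pc.cls δ = Pc.cls δ' :=
  Pc.cls_eq_of_mk_eq (Path.Homotopic.Quotient.eq.2 h)

/-- `cls` is (anti-)multiplicative. [folklore] -/
theorem cls_trans (δ δ' : Path Pc.z₀ Pc.z₀) : Pc.cls (δ.trans δ') = Pc.cls δ' * Pc.cls δ := by
  change Pc.φ _ = Pc.φ _ * Pc.φ _
  rw [← map_mul, _root_.FundamentalGroup.mul_def]
  rfl

/-- `cls` of the constant loop is `1`. [folklore] -/
theorem cls_refl : Pc.cls (Path.refl Pc.z₀) = 1 := by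
  change Pc.φ _ = 1
  rw [← map_one Pc.φ, _root_.FundamentalGroup.one_def]
  rfl

/-- The connecting path to a point of the piece, as a path of the subspace `S`. [folklore] -/
def connZ (z : Pc.S) : Path Pc.z₀ z :=
  liftPath Pc.S (Pc.conn z) (Pc.conn_mem z.2)

/-- Points of `connZ`. [folklore] -/
@[simp]
theorem connZ_apply_coe (z : Pc.S) (t : I) : (Pc.connZ z t : Y) = Pc.conn z t := rfl

/-- **The (ungauged) label of a path inside the piece**: `φ` of the class of
`conn_P · E · conn_P⁻¹`, a loop of the subspace `S`. [cite: HatcherAT2002, proof of Thm. 1.20] -/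
def plab {y y' : Y} (E : Path y y') (hE : ∀ t, E t ∈ Pc.S) : G :=
  Pc.cls (liftPath Pc.S (Pc.loop E) (Pc.loop_mem E hE))

/-- The ungauged label in terms of any loop equal to `loop E`. [folklore] -/
theorem plab_eq_cls_of_loop_eq {y y' : Y} (E : Path y y') (hE : ∀ t, E t ∈ Pc.S)
    {L : Path Δ.x₀ Δ.x₀} (h : Pc.loop E = L) (hL : ∀ t, L t ∈ Pc.S) :
    Pc.plab E hE = Pc.cls (liftPath Pc.S L hL) := by
  subst h
  rfl

/-- The label of a path with a given lift `EZ` to the subspace is `φ [connZ · EZ · connZ⁻¹]`.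
[folklore] -/
theorem plab_eq_of_lift {y y' : Y} (E : Path y y') (hE : ∀ t, E t ∈ Pc.S) {z z' : Pc.S}
    (EZ : Path z z') (h : ∀ t, (EZ t : Y) = E t) :
    Pc.plab E hE = Pc.cls ((Pc.connZ z).trans (EZ.trans (Pc.connZ z').symm)) := by
  obtain ⟨z, hz⟩ := z
  obtain ⟨z', hz'⟩ := z'
  obtain rfl : y = z := by rw [← E.source, ← h 0, EZ.source]
  obtain rfl : y' = z' := by rw [← E.target, ← h 1, EZ.target]
  unfold plab
  congr 1
  ext t
  change Pc.loop E t = _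
  unfold loop
  rw [Path.trans_apply, Path.trans_apply]
  split_ifs with h₁
  · rfl
  · rw [Path.trans_apply, Path.trans_apply]
    split_ifs with h₃
    · exact (h _).symm
    · rfl

/-- Labels are invariant under homotopies inside the piece. [folklore] -/
theorem plab_congr {y y' : Y} {E E' : Path y y'} (h : HomotopicWithin Pc.S E E')
    (hE : ∀ t, E t ∈ Pc.S) (hE' : ∀ t, E' t ∈ Pc.S) : Pc.plab E hE = Pc.plab E' hE' := by
  rw [Pc.plab_eq_of_lift E hE (liftPath Pc.S E hE) (fun _ => rfl),
    Pc.plab_eq_of_lift E' hE' (liftPath Pc.S E' hE') (fun _ => rfl)]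
  exact Pc.cls_congr (Path.Homotopic.hcomp (Path.Homotopic.refl _)
    (Path.Homotopic.hcomp (h.liftPath hE hE') (Path.Homotopic.refl _)))

/-- Labels are (anti-)multiplicative along concatenation inside the piece. [folklore] -/
theorem plab_trans {y y' y'' : Y} (E₁ : Path y y') (E₂ : Path y' y'') (h₁ : ∀ t, E₁ t ∈ Pc.S)
    (h₂ : ∀ t, E₂ t ∈ Pc.S) :
    Pc.plab (E₁.trans E₂) (trans_mem h₁ h₂) = Pc.plab E₂ h₂ * Pc.plab E₁ h₁ := by
  rw [Pc.plab_eq_of_lift _ (trans_mem h₁ h₂) ((liftPath Pc.S E₁ h₁).trans (liftPath Pc.S E₂ h₂))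
      (fun t => by rw [← liftPath_trans Pc.S E₁ E₂ h₁ h₂ (trans_mem h₁ h₂)]; rfl),
    Pc.plab_eq_of_lift E₁ h₁ (liftPath Pc.S E₁ h₁) (fun _ => rfl),
    Pc.plab_eq_of_lift E₂ h₂ (liftPath Pc.S E₂ h₂) (fun _ => rfl), ← Pc.cls_trans]
  apply Pc.cls_eq_of_mk_eq
  simp only [Path.Homotopic.Quotient.mk_trans, Path.Homotopic.Quotient.mk_symm,
    Path.Homotopic.Quotient.trans_assoc, symm_trans_cancel]

/-- A path with constant value in the piece has label `1`. [folklore] -/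
theorem plab_eq_one_of_const {y y' : Y} (E : Path y y') (hE : ∀ t, E t ∈ Pc.S) {c : Y}
    (hc : ∀ t, E t = c) : Pc.plab E hE = 1 := by
  have hcS : c ∈ Pc.S := hc 0 ▸ hE 0
  rw [Pc.plab_eq_of_lift E hE (Path.refl (⟨c, hcS⟩ : Pc.S)) (fun t => (hc t).symm), ← Pc.cls_refl]
  apply Pc.cls_eq_of_mk_eq
  simp only [Path.Homotopic.Quotient.mk_trans, Path.Homotopic.Quotient.mk_symm,
    Path.Homotopic.Quotient.mk_refl, Path.Homotopic.Quotient.refl_trans,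
    Path.Homotopic.Quotient.trans_symm]

/-- The label of a loop at the base point inside the piece is `φ` of its class: the
connecting path of `x₀` is constant. [folklore] -/
theorem plab_loop_at_base (δ : Path Δ.x₀ Δ.x₀) (hδ : ∀ t, δ t ∈ Pc.S) :
    Pc.plab δ hδ = Pc.cls (liftPath Pc.S δ hδ) := by
  rw [Pc.plab_eq_of_lift δ hδ (liftPath Pc.S δ hδ) (fun _ => rfl)]
  have hc : Pc.connZ Pc.z₀ = Path.refl Pc.z₀ := by
    ext t
    change (Pc.conn Δ.x₀ t : Y) = Δ.x₀
    rw [Pc.conn_self]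
    rfl
  rw [hc, Path.refl_symm]
  apply Pc.cls_eq_of_mk_eq
  simp only [Path.Homotopic.Quotient.mk_trans, Path.Homotopic.Quotient.mk_refl,
    Path.Homotopic.Quotient.refl_trans, Path.Homotopic.Quotient.trans_refl]

/-- **The gauged label of a path inside the piece**: `g(y')⁻¹ · φ [conn · E · conn⁻¹] · g(y)`.
[folklore] -/
def glab {y y' : Y} (E : Path y y') (hE : ∀ t, E t ∈ Pc.S) : G :=
  (Pc.gauge y')⁻¹ * Pc.plab E hE * Pc.gauge y

/-- Gauged labels are invariant under homotopies inside the piece. [folklore] -/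
theorem glab_congr {y y' : Y} {E E' : Path y y'} (h : HomotopicWithin Pc.S E E')
    (hE : ∀ t, E t ∈ Pc.S) (hE' : ∀ t, E' t ∈ Pc.S) : Pc.glab E hE = Pc.glab E' hE' := by
  unfold glab
  rw [Pc.plab_congr h hE hE']

/-- Gauged labels are (anti-)multiplicative along concatenation inside the piece (the gauge at
the middle point cancels). [folklore] -/
theorem glab_trans {y y' y'' : Y} (E₁ : Path y y') (E₂ : Path y' y'') (h₁ : ∀ t, E₁ t ∈ Pc.S)
    (h₂ : ∀ t, E₂ t ∈ Pc.S) :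
    Pc.glab (E₁.trans E₂) (trans_mem h₁ h₂) = Pc.glab E₂ h₂ * Pc.glab E₁ h₁ := by
  unfold glab
  rw [Pc.plab_trans E₁ E₂ h₁ h₂]
  simp only [mul_assoc, mul_inv_cancel_left]

/-- A path with constant value in the piece has gauged label `1`. [folklore] -/
theorem glab_eq_one_of_const {y y' : Y} (E : Path y y') (hE : ∀ t, E t ∈ Pc.S) {c : Y}
    (hc : ∀ t, E t = c) : Pc.glab E hE = 1 := by
  have hy : y = c := E.source.symm.trans (hc 0)
  have hy' : y' = c := E.target.symm.trans (hc 1)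
  subst hy hy'
  unfold glab
  rw [Pc.plab_eq_one_of_const E hE hc, mul_one, inv_mul_cancel]

/-- The gauged label of a loop at the base point inside the piece is `φ` of its class (the
gauge at `x₀` is `1`). [folklore] -/
theorem glab_loop_at_base (δ : Path Δ.x₀ Δ.x₀) (hδ : ∀ t, δ t ∈ Pc.S) :
    Pc.glab δ hδ = Pc.cls (liftPath Pc.S δ hδ) := by
  unfold glab
  rw [Pc.gauge_self, inv_one, one_mul, mul_one]
  exact Pc.plab_loop_at_base δ hδ

end Piece

/-! ### Consistency of the two labels on `U ∩ T` -/

/-- On a path inside `C₁` the `U`-loop and the `T`-loop coincide and run in `C₁`. [folklore] -/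
theorem pieceU_loop_eq_pieceT_loop {y y' : Y} (E : Path y y') (h₁ : ∀ t, E t ∈ Δ.C₁) :
    Δ.pieceU.loop E = Δ.pieceT.loop E ∧ ∀ t, Δ.pieceU.loop E t ∈ Δ.C₁ := by
  have hy : y ∈ Δ.C₁ := E.source ▸ h₁ 0
  have hy' : y' ∈ Δ.C₁ := E.target ▸ h₁ 1
  have e1 : Δ.pieceU.loop E = (Δ.conn y).trans (E.trans (Δ.conn y').symm) := by
    change (Δ.connU y).trans (E.trans (Δ.connU y').symm) = _
    rw [Δ.connU_of_not_mem (Δ.not_mem_C₂_of_mem_C₁ hy),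
      Δ.connU_of_not_mem (Δ.not_mem_C₂_of_mem_C₁ hy')]
  have e2 : Δ.pieceT.loop E = (Δ.conn y).trans (E.trans (Δ.conn y').symm) := by
    change (Δ.connT y).trans (E.trans (Δ.connT y').symm) = _
    rw [Δ.connT_of_not_mem (Δ.not_mem_C₂_of_mem_C₁ hy),
      Δ.connT_of_not_mem (Δ.not_mem_C₂_of_mem_C₁ hy')]
  refine ⟨e1.trans e2.symm, ?_⟩
  rw [e1]
  exact trans_mem (Δ.conn_mem_C₁ hy) (trans_mem h₁ (symm_mem (Δ.conn_mem_C₁ hy')))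

omit [Group G] in
/-- Reassociation: the class of the lift of `(η · α) · (E · (η · β)⁻¹)` is that of
`η · ((α · (E · β⁻¹)) · η⁻¹)`. [folklore] -/
theorem mk_liftPath_conj_eq {S : Set Y} {x c y y' : Y} (η : Path x c) (α : Path c y)
    (β : Path c y') (E : Path y y') (hη : ∀ t, η t ∈ S) (hα : ∀ t, α t ∈ S) (hβ : ∀ t, β t ∈ S)
    (hE : ∀ t, E t ∈ S) (h₁ : ∀ t, ((η.trans α).trans (E.trans (η.trans β).symm)) t ∈ S)
    (h₂ : ∀ t, (η.trans ((α.trans (E.trans β.symm)).trans η.symm)) t ∈ S) :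
    Path.Homotopic.Quotient.mk (liftPath S _ h₁) = Path.Homotopic.Quotient.mk (liftPath S _ h₂) := by
  have hηα : ∀ t, (η.trans α) t ∈ S := trans_mem hη hα
  have hηβ : ∀ t, (η.trans β) t ∈ S := trans_mem hη hβ
  have hηβs : ∀ t, (η.trans β).symm t ∈ S := symm_mem hηβ
  have hr : ∀ t, (E.trans (η.trans β).symm) t ∈ S := trans_mem hE hηβs
  rw [liftPath_trans S _ _ hηα hr, liftPath_trans S _ _ hη hα, liftPath_trans S _ _ hE hηβs,
    liftPath_symm S _ hηβ, liftPath_trans S _ _ hη hβ]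
  have hβs : ∀ t, β.symm t ∈ S := symm_mem hβ
  have hEβ : ∀ t, (E.trans β.symm) t ∈ S := trans_mem hE hβs
  have hαEβ : ∀ t, (α.trans (E.trans β.symm)) t ∈ S := trans_mem hα hEβ
  have hηs : ∀ t, η.symm t ∈ S := symm_mem hη
  have hin : ∀ t, ((α.trans (E.trans β.symm)).trans η.symm) t ∈ S := trans_mem hαEβ hηs
  rw [liftPath_trans S _ _ hη hin, liftPath_trans S _ _ hαEβ hηs, liftPath_trans S _ _ hα hEβ,
    liftPath_trans S _ _ hE hβs, liftPath_symm S _ hβ, liftPath_symm S _ hη]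
  simp only [Path.Homotopic.Quotient.mk_trans, Path.Homotopic.Quotient.mk_symm, Path.trans_symm,
    Path.Homotopic.Quotient.trans_assoc]

/-- **Consistency**: on a path inside `U ∩ T` the gauged `U`-label and `T`-label agree.  Inside
`C₁` this is condition (1) of the datum; inside `C₂` the loops are `η_P · (a · E · a'⁻¹) · η_P⁻¹`
up to reassociation, the gauges are `1` for `U` and `τ` at both ends for `T`, and condition (2)
applies. [folklore] -/
theorem glab_pieceU_eq_glab_pieceT {y y' : Y} (E : Path y y') (hU : ∀ t, E t ∈ Δ.U)
    (hT : ∀ t, E t ∈ Δ.T) : Δ.pieceU.glab E hU = Δ.pieceT.glab E hT := by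
  rcases Δ.forall_mem_C₁_or_C₂ E hU hT with h₁ | h₂
  · ---- inside `C₁`
    have hy : y ∈ Δ.C₁ := E.source ▸ h₁ 0
    have hy' : y' ∈ Δ.C₁ := E.target ▸ h₁ 1
    obtain ⟨hloop, hloopC⟩ := Δ.pieceU_loop_eq_pieceT_loop E h₁
    have hLU : ∀ t, Δ.pieceU.loop E t ∈ Δ.U := fun t => Δ.C₁_subset_U (hloopC t)
    have hLT : ∀ t, Δ.pieceU.loop E t ∈ Δ.T := fun t => Δ.C₁_subset_T (hloopC t)
    unfold Piece.glab
    rw [pieceU_gauge, pieceU_gauge, Δ.pieceT_gauge_of_not_mem (Δ.not_mem_C₂_of_mem_C₁ hy),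
      Δ.pieceT_gauge_of_not_mem (Δ.not_mem_C₂_of_mem_C₁ hy'), inv_one, one_mul, mul_one,
      one_mul, mul_one, Δ.pieceT.plab_eq_cls_of_loop_eq E hT hloop.symm hLT]
    exact Δ.compat₁ (Δ.pieceU.loop E) hLU hLT hloopC
  · ---- inside `C₂`
    have hy : y ∈ Δ.C₂ := E.source ▸ h₂ 0
    have hy' : y' ∈ Δ.C₂ := E.target ▸ h₂ 1
    set δ : Path Δ.c₂ Δ.c₂ := (Δ.arc y hy).trans (E.trans (Δ.arc y' hy').symm) with hδ
    have hδC : ∀ t, δ t ∈ Δ.C₂ := trans_mem (Δ.arc_mem hy) (trans_mem h₂ (symm_mem (Δ.arc_mem hy')))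
    have hLU : ∀ t, (Δ.ηU.trans (δ.trans Δ.ηU.symm)) t ∈ Δ.U :=
      trans_mem Δ.ηU_mem (trans_mem (fun t => Δ.C₂_subset_U (hδC t)) (symm_mem Δ.ηU_mem))
    have hLT : ∀ t, (Δ.ηT.trans (δ.trans Δ.ηT.symm)) t ∈ Δ.T :=
      trans_mem Δ.ηT_mem (trans_mem (fun t => Δ.C₂_subset_T (hδC t)) (symm_mem Δ.ηT_mem))
    have key := Δ.compat₂ δ hδC hLU hLT
    have eU : Δ.pieceU.loop E = (Δ.ηU.trans (Δ.arc y hy)).trans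
        (E.trans (Δ.ηU.trans (Δ.arc y' hy')).symm) := by
      change (Δ.connU y).trans (E.trans (Δ.connU y').symm) = _
      rw [Δ.connU_of_mem hy, Δ.connU_of_mem hy']
    have eT : Δ.pieceT.loop E = (Δ.ηT.trans (Δ.arc y hy)).trans
        (E.trans (Δ.ηT.trans (Δ.arc y' hy')).symm) := by
      change (Δ.connT y).trans (E.trans (Δ.connT y').symm) = _
      rw [Δ.connT_of_mem hy, Δ.connT_of_mem hy']
    have hLU' : ∀ t, ((Δ.ηU.trans (Δ.arc y hy)).trans (E.trans (Δ.ηU.trans (Δ.arc y' hy')).symm)) t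
        ∈ Δ.U := fun t => eU ▸ Δ.pieceU.loop_mem E hU t
    have hLT' : ∀ t, ((Δ.ηT.trans (Δ.arc y hy)).trans (E.trans (Δ.ηT.trans (Δ.arc y' hy')).symm)) t
        ∈ Δ.T := fun t => eT ▸ Δ.pieceT.loop_mem E hT t
    unfold Piece.glab
    rw [pieceU_gauge, pieceU_gauge, Δ.pieceT_gauge_of_mem hy, Δ.pieceT_gauge_of_mem hy', inv_one,
      one_mul, mul_one, Δ.pieceU.plab_eq_cls_of_loop_eq E hU eU hLU',
      Δ.pieceT.plab_eq_cls_of_loop_eq E hT eT hLT']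
    change Δ.φU (_root_.FundamentalGroup.fromPath (Path.Homotopic.Quotient.mk (liftPath Δ.U _ hLU'))) =
      Δ.τ⁻¹ * Δ.φT (_root_.FundamentalGroup.fromPath (Path.Homotopic.Quotient.mk
        (liftPath Δ.T _ hLT'))) * Δ.τ
    rw [mk_liftPath_conj_eq Δ.ηU (Δ.arc y hy) (Δ.arc y' hy') E Δ.ηU_mem
        (fun t => Δ.C₂_subset_U (Δ.arc_mem hy t)) (fun t => Δ.C₂_subset_U (Δ.arc_mem hy' t)) hU
        hLU' hLU,
      mk_liftPath_conj_eq Δ.ηT (Δ.arc y hy) (Δ.arc y' hy') E Δ.ηT_mem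
        (fun t => Δ.C₂_subset_T (Δ.arc_mem hy t)) (fun t => Δ.C₂_subset_T (Δ.arc_mem hy' t)) hT
        hLT' hLT]
    exact key

/-! ### The label of an arbitrary path -/

open Classical in
/-- **The label of a path** `E` of `Y`: the gauged `U`-label if `E` runs in `U`, else the gauged
`T`-label if `E` runs in `T`, else `1` (junk). [cite: HatcherAT2002, proof of Thm. 1.20] -/
def lab {y y' : Y} (E : Path y y') : G :=
  if hU : ∀ t, E t ∈ Δ.U then Δ.pieceU.glab E hU
  else if hT : ∀ t, E t ∈ Δ.T then Δ.pieceT.glab E hT else 1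

/-- The label of a path inside `U` is its gauged `U`-label. [folklore] -/
theorem lab_eq_glab_U {y y' : Y} (E : Path y y') (hU : ∀ t, E t ∈ Δ.U) :
    Δ.lab E = Δ.pieceU.glab E hU := by
  unfold lab
  rw [dif_pos hU]

/-- The label of a path inside `T` is its gauged `T`-label. [folklore] -/
theorem lab_eq_glab_T {y y' : Y} (E : Path y y') (hT : ∀ t, E t ∈ Δ.T) :
    Δ.lab E = Δ.pieceT.glab E hT := by
  unfold lab
  split_ifs with hU
  · exact Δ.glab_pieceU_eq_glab_pieceT E hU hT
  · rfl

/-- The label of a path inside a piece is its gauged label for that piece. [folklore] -/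
theorem lab_eq_glab (P : Δ.Piece) (hP : P = Δ.pieceU ∨ P = Δ.pieceT) {y y' : Y} (E : Path y y')
    (hE : ∀ t, E t ∈ P.S) : Δ.lab E = P.glab E hE := by
  rcases hP with rfl | rfl
  · exact Δ.lab_eq_glab_U E hE
  · exact Δ.lab_eq_glab_T E hE

/-- Pointwise equal paths have the same label. [folklore] -/
theorem lab_congr_pt {y y' w w' : Y} (E : Path y y') (E' : Path w w') (h : ∀ s, E s = E' s) :
    Δ.lab E = Δ.lab E' := by
  obtain rfl : y = w := by rw [← E.source, ← E'.source, h]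
  obtain rfl : y' = w' := by rw [← E.target, ← E'.target, h]
  obtain rfl : E = E' := Path.ext (funext h)
  rfl

/-- Labels are (anti-)multiplicative along concatenation inside a piece. [folklore] -/
theorem lab_trans (P : Δ.Piece) (hP : P = Δ.pieceU ∨ P = Δ.pieceT) {y y' y'' : Y}
    (E₁ : Path y y') (E₂ : Path y' y'') (h₁ : ∀ t, E₁ t ∈ P.S) (h₂ : ∀ t, E₂ t ∈ P.S) :
    Δ.lab (E₁.trans E₂) = Δ.lab E₂ * Δ.lab E₁ := by
  rw [Δ.lab_eq_glab P hP _ (trans_mem h₁ h₂), Δ.lab_eq_glab P hP _ h₁, Δ.lab_eq_glab P hP _ h₂]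
  exact P.glab_trans E₁ E₂ h₁ h₂

/-- Labels are invariant under homotopies inside a piece. [folklore] -/
theorem lab_congr (P : Δ.Piece) (hP : P = Δ.pieceU ∨ P = Δ.pieceT) {y y' : Y} {E E' : Path y y'}
    (h : HomotopicWithin P.S E E') : Δ.lab E = Δ.lab E' := by
  rw [Δ.lab_eq_glab P hP E h.left_mem, Δ.lab_eq_glab P hP E' h.right_mem]
  exact P.glab_congr h h.left_mem h.right_mem

/-- A constant path has label `1`. [folklore] -/
theorem lab_eq_one_of_const {y y' : Y} (E : Path y y') {c : Y} (hc : ∀ t, E t = c) :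
    Δ.lab E = 1 := by
  rcases Δ.mem_or_mem c with hcU | hcT
  · have hE : ∀ t, E t ∈ Δ.U := fun t => (hc t).symm ▸ hcU
    rw [Δ.lab_eq_glab_U E hE]
    exact Δ.pieceU.glab_eq_one_of_const E hE hc
  · have hE : ∀ t, E t ∈ Δ.T := fun t => (hc t).symm ▸ hcT
    rw [Δ.lab_eq_glab_T E hE]
    exact Δ.pieceT.glab_eq_one_of_const E hE hc

/-! ### Products of labels along a subdivided path -/

/-- **The product of the labels** of the first `k` edges of the `n`-fold subdivision of a path
(reversed order). [cite: HatcherAT2002, proof of Thm. 1.20] -/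
def pathProd {y y' : Y} (E : Path y y') (n k : ℕ) : G :=
  rowProd (fun _ j => Δ.lab (PushoutData.edge E n j)) 0 k

/-- A subdivision of a path is *admissible* if every edge runs in `U` or in `T`. [folklore] -/
def Adm {y y' : Y} (E : Path y y') (n : ℕ) : Prop :=
  0 < n ∧ ∀ j, j < n →
    (∀ s, PushoutData.edge E n j s ∈ Δ.U) ∨ (∀ s, PushoutData.edge E n j s ∈ Δ.T)

/-- **Admissible subdivisions exist** (Lebesgue number lemma). [folklore] -/
theorem exists_adm {y y' : Y} (E : Path y y') : ∃ n, Δ.Adm E n := by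
  let F : C(I × I, Y) := ⟨fun p => E p.2, by fun_prop⟩
  obtain ⟨n, hn, hsq⟩ := exists_grid F Δ.hUo Δ.hTo fun x => Δ.mem_or_mem _
  refine ⟨n, hn, fun j hj => ?_⟩
  rcases hsq 0 j hn hj with h | h
  · exact Or.inl fun s => h (hEdge_mem n 0 j s)
  · exact Or.inr fun s => h (hEdge_mem n 0 j s)

variable {Δ} in
/-- In an admissible subdivision every edge runs in one of the two pieces. [folklore] -/
theorem Adm.exists_piece {y y' : Y} {E : Path y y'} {n : ℕ} (h : Δ.Adm E n) {j : ℕ}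
    (hj : j < n) :
    ∃ P : Δ.Piece, (P = Δ.pieceU ∨ P = Δ.pieceT) ∧ ∀ s, PushoutData.edge E n j s ∈ P.S := by
  rcases h.2 j hj with hU | hT
  · exact ⟨Δ.pieceU, Or.inl rfl, hU⟩
  · exact ⟨Δ.pieceT, Or.inr rfl, hT⟩

variable {Δ} in
/-- Admissibility is preserved under refinement. [folklore] -/
theorem Adm.mul {y y' : Y} {E : Path y y'} {n : ℕ} (h : Δ.Adm E n) {m : ℕ} (hm : 0 < m) :
    Δ.Adm E (n * m) := by
  refine ⟨Nat.mul_pos h.1 hm, fun J hJ => ?_⟩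
  have hJ' : J = J / m * m + J % m := (Nat.div_add_mod' J m).symm
  have hkn : J / m < n := Nat.div_lt_of_lt_mul (by rwa [Nat.mul_comm] at hJ)
  have hlm : J % m < m := Nat.mod_lt _ hm
  rw [hJ']
  rcases h.2 (J / m) hkn with hU | hT
  · exact Or.inl fun s => by rw [PushoutData.edge_mul_apply E h.1 hm hkn hlm s]; exact hU _
  · exact Or.inr fun s => by rw [PushoutData.edge_mul_apply E h.1 hm hkn hlm s]; exact hT _

/-! ### A path inside one piece: the product of the labels of its edges is its label -/

omit [TopologicalSpace Y] in
/-- Gauging a row of factors: if `H' j = g(j+1)⁻¹ · H j · g(j)` for `j < l` then the row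
products of the first `l` factors differ by the gauges at the two ends. [folklore] -/
theorem rowProd_gauge (H H' : ℕ → ℕ → G) (g : ℕ → G) (l : ℕ)
    (h : ∀ j, j < l → H' 0 j = (g (j + 1))⁻¹ * H 0 j * g j) :
    rowProd H' 0 l = (g l)⁻¹ * rowProd H 0 l * g 0 := by
  induction l with
  | zero => simp
  | succ l ih =>
    rw [rowProd_succ, rowProd_succ, ih fun j hj => h j (Nat.lt_succ_of_lt hj), h l l.lt_succ_self]
    simp only [mul_assoc, mul_inv_cancel_left]

/-- **Ungauged telescoping inside a piece** (as in `VanKampenPushout.lean`): the product of the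
ungauged labels of the first `l` edges of the `m`-fold subdivision of a path `Q` running in a
piece is `φ [conn · Q|[0, l/m] · conn⁻¹]`. [folklore] -/
theorem rowProd_plab_edge_eq_cls (P : Δ.Piece) {y y' : Y} (Q : Path y y') (hQ : ∀ t, Q t ∈ P.S)
    (m l : ℕ) :
    rowProd (fun _ j => P.plab (PushoutData.edge Q m j) (fun _ => hQ _)) 0 l =
      P.cls ((P.connZ (liftPath P.S Q hQ (gc m 0))).trans
        (((liftPath P.S Q hQ).subpath (gc m 0) (gc m l)).trans
          (P.connZ (liftPath P.S Q hQ (gc m l))).symm)) := by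
  set QZ := liftPath P.S Q hQ with hQZ
  induction l with
  | zero =>
    rw [rowProd_zero, Path.subpath_self, ← P.cls_refl]
    apply P.cls_eq_of_mk_eq
    simp only [Path.Homotopic.Quotient.mk_trans, Path.Homotopic.Quotient.mk_symm,
      Path.Homotopic.Quotient.mk_refl, Path.Homotopic.Quotient.refl_trans,
      Path.Homotopic.Quotient.trans_symm]
  | succ l ih =>
    rw [rowProd_succ, ih]
    have hl : P.plab (PushoutData.edge Q m l) (fun _ => hQ _) = P.cls ((P.connZ (QZ (gc m l))).trans
        ((QZ.subpath (gc m l) (gc m (l + 1))).trans (P.connZ (QZ (gc m (l + 1)))).symm)) :=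
      P.plab_eq_of_lift _ _ _ (fun _ => rfl)
    rw [hl, ← P.cls_trans]
    apply P.cls_eq_of_mk_eq
    have hS : ∀ ρ : Path.Homotopic.Quotient (QZ (gc m (l + 1))) P.z₀,
        (Path.Homotopic.Quotient.mk (QZ.subpath (gc m 0) (gc m l))).trans
          ((Path.Homotopic.Quotient.mk (QZ.subpath (gc m l) (gc m (l + 1)))).trans ρ) =
        (Path.Homotopic.Quotient.mk (QZ.subpath (gc m 0) (gc m (l + 1)))).trans ρ := by
      intro ρ
      rw [← Path.Homotopic.Quotient.trans_assoc, ← Path.Homotopic.Quotient.mk_trans,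
        Path.Homotopic.Quotient.eq.2 ⟨Path.Homotopy.subpathTransSubpath QZ _ _ _⟩]
    simp only [Path.Homotopic.Quotient.mk_trans, Path.Homotopic.Quotient.mk_symm,
      Path.Homotopic.Quotient.trans_assoc, symm_trans_cancel, hS]

/-- **Telescoping inside a piece.** For a path `Q` running in a piece, the product of the labels
of the first `l` edges of its `m`-fold subdivision is
`g(Q(l/m))⁻¹ · φ [conn · Q|[0, l/m] · conn⁻¹] · g(Q(0))`. [folklore] -/
theorem rowProd_edge_eq_cls (P : Δ.Piece) (hP : P = Δ.pieceU ∨ P = Δ.pieceT) {y y' : Y}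
    (Q : Path y y') (hQ : ∀ t, Q t ∈ P.S) (m l : ℕ) :
    rowProd (fun _ j => Δ.lab (PushoutData.edge Q m j)) 0 l =
      (P.gauge (Q (gc m l)))⁻¹ * P.cls ((P.connZ (liftPath P.S Q hQ (gc m 0))).trans
        (((liftPath P.S Q hQ).subpath (gc m 0) (gc m l)).trans
          (P.connZ (liftPath P.S Q hQ (gc m l))).symm)) * P.gauge (Q (gc m 0)) := by
  have hlab : ∀ j, j < l → Δ.lab (PushoutData.edge Q m j) = (P.gauge (Q (gc m (j + 1))))⁻¹ *
      P.plab (PushoutData.edge Q m j) (fun _ => hQ _) * P.gauge (Q (gc m j)) := fun j _ => by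
    rw [Δ.lab_eq_glab P hP (PushoutData.edge Q m j) (fun _ => hQ _)]
    rfl
  rw [rowProd_gauge (fun _ j => P.plab (PushoutData.edge Q m j) (fun _ => hQ _))
      (fun _ j => Δ.lab (PushoutData.edge Q m j)) (fun j => P.gauge (Q (gc m j))) l hlab,
    Δ.rowProd_plab_edge_eq_cls P Q hQ m l]

/-- **A path inside one piece**: the product of the labels of the edges of any subdivision is
the label of the path. [folklore] -/
theorem pathProd_eq_lab (P : Δ.Piece) (hP : P = Δ.pieceU ∨ P = Δ.pieceT) {y y' : Y}
    (Q : Path y y') (hQ : ∀ t, Q t ∈ P.S) {m : ℕ} (hm : 0 < m) :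
    Δ.pathProd Q m m = Δ.lab Q := by
  rw [pathProd, Δ.rowProd_edge_eq_cls P hP Q hQ m m, Δ.lab_eq_glab P hP Q hQ]
  unfold Piece.glab
  have h0 : Q (gc m 0) = y := by rw [gc_zero]; exact Q.source
  have h1 : Q (gc m m) = y' := by rw [gc_self hm]; exact Q.target
  rw [h0, h1]
  congr 2
  symm
  apply P.plab_eq_of_lift
  intro t
  change Q _ = Q t
  rw [gc_zero, gc_self hm, Set.Icc.convexComb_zero_one]

/-! ### Refinement invariance -/

/-- **Refining an admissible subdivision does not change the product of labels.** [folklore] -/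
theorem pathProd_mul {y y' : Y} {E : Path y y'} {n : ℕ} (h : Δ.Adm E n) {m : ℕ} (hm : 0 < m) :
    ∀ k, k ≤ n → Δ.pathProd E (n * m) (k * m) = Δ.pathProd E n k := by
  intro k
  induction k with
  | zero => intro; simp [pathProd]
  | succ k ih =>
    intro hk
    have hkn : k < n := hk
    obtain ⟨P, hP, hPS⟩ := h.exists_piece hkn
    have hkm : (k + 1) * m = k * m + m := by ring
    have e1 : Δ.pathProd E (n * m) ((k + 1) * m) =
        rowProd (fun _ j => Δ.lab (PushoutData.edge E (n * m) (k * m + j))) 0 m *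
          Δ.pathProd E (n * m) (k * m) := by
      rw [hkm]
      exact PushoutData.rowProd_add _ 0 (k * m) m
    have e2 : Δ.pathProd E n (k + 1) = Δ.lab (PushoutData.edge E n k) * Δ.pathProd E n k := rfl
    rw [e1, e2, ih hkn.le]
    congr 1
    rw [← Δ.pathProd_eq_lab P hP (PushoutData.edge E n k) hPS hm]
    exact PushoutData.rowProd_congr m fun j hj => Δ.lab_congr_pt _ _ fun s =>
      PushoutData.edge_mul_apply E h.1 hm hkn hj s

/-- Refinement invariance, full products. [folklore] -/
theorem pathProd_mul_self {y y' : Y} {E : Path y y'} {n : ℕ} (h : Δ.Adm E n) {m : ℕ}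
    (hm : 0 < m) : Δ.pathProd E (n * m) (n * m) = Δ.pathProd E n n :=
  Δ.pathProd_mul h hm n le_rfl

/-- **Two admissible subdivisions give the same product of labels.** [folklore] -/
theorem pathProd_eq_of_adm {y y' : Y} {E : Path y y'} {n n' : ℕ} (h : Δ.Adm E n)
    (h' : Δ.Adm E n') : Δ.pathProd E n n = Δ.pathProd E n' n' := by
  rw [← Δ.pathProd_mul_self h h'.1, ← Δ.pathProd_mul_self h' h.1, Nat.mul_comm]

/-! ### Homotopy invariance: the grid argument -/

/-- A subdivision of the square is *fine* for a map `F` if every grid square is mapped into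
`U` or into `T`. [folklore] -/
def Fine (F : C(I × I, Y)) (n : ℕ) : Prop :=
  0 < n ∧ ∀ i j, i < n → j < n → MapsTo F (sq n i j) Δ.U ∨ MapsTo F (sq n i j) Δ.T

/-- Fine subdivisions exist (Lebesgue number lemma, `exists_grid`). [folklore] -/
theorem exists_fine (F : C(I × I, Y)) : ∃ n, Δ.Fine F n :=
  exists_grid F Δ.hUo Δ.hTo fun x => Δ.mem_or_mem (F x)

variable {Δ} in
/-- A subdivision fine for a homotopy is admissible for its initial path. [folklore] -/
theorem Fine.adm_left {y y' : Y} {E E' : Path y y'} (F : E.Homotopy E') {n : ℕ}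
    (h : Δ.Fine F.toContinuousMap n) : Δ.Adm E n := by
  refine ⟨h.1, fun j hj => ?_⟩
  have key : ∀ s, PushoutData.edge E n j s = F.toContinuousMap (gc n 0, Set.Icc.convexComb (gc n j)
      (gc n (j + 1)) s) := fun s => by
    rw [gc_zero]; exact (F.apply_zero _).symm
  rcases h.2 0 j h.1 hj with hU | hT
  · exact Or.inl fun s => by rw [key]; exact hU (hEdge_mem n 0 j s)
  · exact Or.inr fun s => by rw [key]; exact hT (hEdge_mem n 0 j s)

variable {Δ} in
/-- A subdivision fine for a homotopy is admissible for its final path. [folklore] -/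
theorem Fine.adm_right {y y' : Y} {E E' : Path y y'} (F : E.Homotopy E') {n : ℕ}
    (h : Δ.Fine F.toContinuousMap n) : Δ.Adm E' n := by
  refine ⟨h.1, fun j hj => ?_⟩
  obtain ⟨m, rfl⟩ : ∃ m, n = m + 1 := ⟨n - 1, by omega⟩
  have key : ∀ s, PushoutData.edge E' (m + 1) j s = F.toContinuousMap (gc (m + 1) (m + 1),
      Set.Icc.convexComb (gc (m + 1) j) (gc (m + 1) (j + 1)) s) := fun s => by
    rw [gc_self h.1]; exact (F.apply_one _).symm
  rcases h.2 m j m.lt_succ_self hj with hU | hT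
  · exact Or.inl fun s => by rw [key]; exact hU (hEdge_succ_mem (m + 1) m j s)
  · exact Or.inr fun s => by rw [key]; exact hT (hEdge_succ_mem (m + 1) m j s)

/-- **Homotopy invariance.** For a homotopy `F` (rel endpoints) from `E` to `E'` and a
subdivision fine for `F`, the products of the labels of the edges of `E` and of `E'` agree.
[cite: HatcherAT2002, proof of Thm. 1.20] -/
theorem pathProd_eq_of_homotopy {y y' : Y} {E E' : Path y y'} (F : E.Homotopy E') {n : ℕ}
    (hF : Δ.Fine F.toContinuousMap n) : Δ.pathProd E n n = Δ.pathProd E' n n := by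
  set Fc : C(I × I, Y) := F.toContinuousMap with hFc
  obtain ⟨hn, hsq⟩ := hF
  let H : ℕ → ℕ → G := fun i j => Δ.lab (hEdge Fc n i j)
  let V : ℕ → ℕ → G := fun i j => Δ.lab (vEdge Fc n i j)
  -- square relations
  have rel : ∀ i j, i < n → j < n → V i (j + 1) * H i j = H (i + 1) j * V i j := by
    intro i j hi hj
    obtain ⟨P, hP, hPS⟩ : ∃ P : Δ.Piece, (P = Δ.pieceU ∨ P = Δ.pieceT) ∧
        MapsTo Fc (sq n i j) P.S := by
      rcases hsq i j hi hj with h | h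
      · exact ⟨Δ.pieceU, Or.inl rfl, h⟩
      · exact ⟨Δ.pieceT, Or.inr rfl, h⟩
    have hbS : ∀ u, hEdge Fc n i j u ∈ P.S := fun u => hPS (hEdge_mem n i j u)
    have htS : ∀ u, hEdge Fc n (i + 1) j u ∈ P.S := fun u => hPS (hEdge_succ_mem n i j u)
    have hlS : ∀ u, vEdge Fc n i j u ∈ P.S := fun u => hPS (vEdge_mem n i j u)
    have hrS : ∀ u, vEdge Fc n i (j + 1) u ∈ P.S := fun u => hPS (vEdge_succ_mem n i j u)
    have hw : HomotopicWithin P.S ((hEdge Fc n i j).trans (vEdge Fc n i (j + 1)))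
        ((vEdge Fc n i j).trans (hEdge Fc n (i + 1) j)) := by
      refine homotopicWithin_of_square (Fc.comp (sqMap n i j)) (fun p => hPS (sqMap_mem n i j p))
        _ _ _ _ (fun u => ?_) (fun u => ?_) (fun u => ?_) (fun u => ?_)
      · rw [hEdge_apply, ContinuousMap.comp_apply, sqMap_apply, Set.Icc.convexComb_zero]
      · rw [vEdge_apply, ContinuousMap.comp_apply, sqMap_apply, Set.Icc.convexComb_one]
      · rw [vEdge_apply, ContinuousMap.comp_apply, sqMap_apply, Set.Icc.convexComb_zero]
      · rw [hEdge_apply, ContinuousMap.comp_apply, sqMap_apply, Set.Icc.convexComb_one]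
    have e := Δ.lab_congr P hP hw
    rw [Δ.lab_trans P hP _ _ hbS hrS, Δ.lab_trans P hP _ _ hlS htS] at e
    exact e
  have hleft : ∀ i, i < n → V i 0 = 1 := fun i _ =>
    Δ.lab_eq_one_of_const _ fun u => by rw [vEdge_apply, gc_zero]; exact F.source _
  have hright : ∀ i, i < n → V i n = 1 := fun i _ =>
    Δ.lab_eq_one_of_const _ fun u => by rw [vEdge_apply, gc_self hn]; exact F.target _
  have hgrid := PushoutData.rowProd_eq_rowProd_of_grid n H V rel hleft hright
  have hbot : rowProd H 0 n = Δ.pathProd E n n :=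
    PushoutData.rowProd_congr n fun j _ => Δ.lab_congr_pt _ _ fun u => by
      rw [hEdge_apply, gc_zero]; exact F.apply_zero _
  have htop : rowProd H n n = Δ.pathProd E' n n :=
    PushoutData.rowProd_congr n fun j _ => Δ.lab_congr_pt _ _ fun u => by
      rw [hEdge_apply, gc_self hn]; exact F.apply_one _
  rw [← hbot, ← htop]
  exact hgrid

/-! ### The label of a path and of a homotopy class -/

/-- **The label of a path**: the product of the labels of the edges of some (any) admissible
subdivision. [cite: HatcherAT2002, proof of Thm. 1.20] -/
def pathLabel {y y' : Y} (E : Path y y') : G :=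
  Δ.pathProd E (Classical.choose (Δ.exists_adm E)) (Classical.choose (Δ.exists_adm E))

/-- The label of a path is computed by any admissible subdivision. [folklore] -/
theorem pathLabel_eq_pathProd {y y' : Y} {E : Path y y'} {n : ℕ} (h : Δ.Adm E n) :
    Δ.pathLabel E = Δ.pathProd E n n :=
  Δ.pathProd_eq_of_adm (Classical.choose_spec (Δ.exists_adm E)) h

/-- **Homotopic paths have the same label.** [cite: HatcherAT2002, proof of Thm. 1.20] -/
theorem pathLabel_eq_of_homotopic {y y' : Y} {E E' : Path y y'} (h : E.Homotopic E') :
    Δ.pathLabel E = Δ.pathLabel E' := by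
  obtain ⟨F⟩ := h
  obtain ⟨n, hF⟩ := Δ.exists_fine F.toContinuousMap
  rw [Δ.pathLabel_eq_pathProd (hF.adm_left F), Δ.pathLabel_eq_pathProd (hF.adm_right F)]
  exact Δ.pathProd_eq_of_homotopy F hF

/-- **The label of a path inside a piece** is its (gauged) label for that piece. [folklore] -/
theorem pathLabel_eq_lab (P : Δ.Piece) (hP : P = Δ.pieceU ∨ P = Δ.pieceT) {y y' : Y}
    (E : Path y y') (hE : ∀ t, E t ∈ P.S) : Δ.pathLabel E = Δ.lab E := by
  have h1 : Δ.Adm E 1 := by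
    refine ⟨Nat.one_pos, fun j hj => ?_⟩
    rcases hP with rfl | rfl
    · exact Or.inl fun s => hE _
    · exact Or.inr fun s => hE _
  rw [Δ.pathLabel_eq_pathProd h1]
  exact Δ.pathProd_eq_lab P hP E hE Nat.one_pos

/-- **The label of a loop at the base point inside a piece is `φ` of its class.** [folklore] -/
theorem pathLabel_loop (P : Δ.Piece) (hP : P = Δ.pieceU ∨ P = Δ.pieceT) (δ : Path Δ.x₀ Δ.x₀)
    (hδ : ∀ t, δ t ∈ P.S) : Δ.pathLabel δ = P.cls (liftPath P.S δ hδ) := by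
  rw [Δ.pathLabel_eq_lab P hP δ hδ, Δ.lab_eq_glab P hP δ hδ]
  exact P.glab_loop_at_base δ hδ

/-- The label of a constant path is `1`. [folklore] -/
theorem pathLabel_refl (y : Y) : Δ.pathLabel (Path.refl y) = 1 := by
  rcases Δ.mem_or_mem y with hy | hy
  · rw [Δ.pathLabel_eq_lab Δ.pieceU (Or.inl rfl) _ (fun _ => hy)]
    exact Δ.lab_eq_one_of_const _ fun _ => rfl
  · rw [Δ.pathLabel_eq_lab Δ.pieceT (Or.inr rfl) _ (fun _ => hy)]
    exact Δ.lab_eq_one_of_const _ fun _ => rfl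

variable {Δ} in
/-- Admissible subdivisions of the factors give an admissible subdivision of the
concatenation. [folklore] -/
theorem Adm.trans {y y' y'' : Y} {E₁ : Path y y'} {E₂ : Path y' y''} {n : ℕ} (h₁ : Δ.Adm E₁ n)
    (h₂ : Δ.Adm E₂ n) : Δ.Adm (E₁.trans E₂) (n * 2) := by
  refine ⟨Nat.mul_pos h₁.1 two_pos, fun J hJ => ?_⟩
  rcases Nat.lt_or_ge J n with hJn | hJn
  · rcases h₁.2 J hJn with h | h
    · exact Or.inl fun s => by rw [PushoutData.edge_trans_left E₁ E₂ h₁.1 hJn]; exact h s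
    · exact Or.inr fun s => by rw [PushoutData.edge_trans_left E₁ E₂ h₁.1 hJn]; exact h s
  · obtain ⟨J, rfl⟩ : ∃ J', J = n + J' := ⟨J - n, by omega⟩
    have hJ' : J < n := by omega
    rcases h₂.2 J hJ' with h | h
    · exact Or.inl fun s => by rw [PushoutData.edge_trans_right E₁ E₂ h₁.1 hJ']; exact h s
    · exact Or.inr fun s => by rw [PushoutData.edge_trans_right E₁ E₂ h₁.1 hJ']; exact h s

/-- **The label of a concatenation is the product of the labels** (reversed order).
[cite: HatcherAT2002, proof of Thm. 1.20] -/
theorem pathLabel_trans {y y' y'' : Y} (E₁ : Path y y') (E₂ : Path y' y'') :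
    Δ.pathLabel (E₁.trans E₂) = Δ.pathLabel E₂ * Δ.pathLabel E₁ := by
  obtain ⟨n₁, h₁⟩ := Δ.exists_adm E₁
  obtain ⟨n₂, h₂⟩ := Δ.exists_adm E₂
  have h₁' : Δ.Adm E₁ (n₁ * n₂) := h₁.mul h₂.1
  have h₂' : Δ.Adm E₂ (n₁ * n₂) := by rw [Nat.mul_comm]; exact h₂.mul h₁.1
  set n := n₁ * n₂ with hn
  have hn0 : 0 < n := h₁'.1
  rw [Δ.pathLabel_eq_pathProd (h₁'.trans h₂'), Δ.pathLabel_eq_pathProd h₁',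
    Δ.pathLabel_eq_pathProd h₂', pathProd, Nat.mul_two, PushoutData.rowProd_add]
  congr 1
  · exact PushoutData.rowProd_congr n fun j hj => Δ.lab_congr_pt _ _ fun s =>
      (Nat.mul_two n) ▸ PushoutData.edge_trans_right E₁ E₂ hn0 hj s
  · exact PushoutData.rowProd_congr n fun j hj => Δ.lab_congr_pt _ _ fun s =>
      (Nat.mul_two n) ▸ PushoutData.edge_trans_left E₁ E₂ hn0 hj s

/-! ### The induced homomorphism `π₁(Y, x₀) → G` -/

/-- The label of a homotopy class of paths. [folklore] -/
def classLabel {y y' : Y} : Path.Homotopic.Quotient y y' → G :=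
  Quotient.lift (fun E => Δ.pathLabel E) fun _ _ h => Δ.pathLabel_eq_of_homotopic h

/-- The label of the class of a path is the label of the path. [folklore] -/
@[simp]
theorem classLabel_mk {y y' : Y} (E : Path y y') :
    Δ.classLabel (Path.Homotopic.Quotient.mk E) = Δ.pathLabel E := rfl

/-- Class labels are (anti-)multiplicative. [folklore] -/
theorem classLabel_trans {y y' y'' : Y} (p : Path.Homotopic.Quotient y y')
    (q : Path.Homotopic.Quotient y' y'') :
    Δ.classLabel (p.trans q) = Δ.classLabel q * Δ.classLabel p := by
  induction p using Path.Homotopic.Quotient.ind with | mk E₁ =>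
  induction q using Path.Homotopic.Quotient.ind with | mk E₂ =>
  rw [← Path.Homotopic.Quotient.mk_trans, classLabel_mk, classLabel_mk, classLabel_mk]
  exact Δ.pathLabel_trans E₁ E₂

/-- **The Seifert–van Kampen homomorphism** `Φ : π₁(Y, x₀) → G` of the datum: the class of a
loop goes to the product of the gauged labels of the edges of any admissible subdivision.
[cite: HatcherAT2002, Thm. 1.20] -/
def lift : _root_.FundamentalGroup Y Δ.x₀ →* G where
  toFun a := Δ.classLabel (_root_.FundamentalGroup.toPath a)
  map_one' := by
    change Δ.classLabel (Path.Homotopic.Quotient.mk (Path.refl Δ.x₀)) = 1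
    rw [classLabel_mk]
    exact Δ.pathLabel_refl Δ.x₀
  map_mul' a b := by
    change Δ.classLabel ((_root_.FundamentalGroup.toPath b).trans
      (_root_.FundamentalGroup.toPath a)) = _
    exact Δ.classLabel_trans _ _

/-- The van Kampen homomorphism on the class of a loop is the label of the loop. [folklore] -/
theorem lift_fromPath (γ : Path Δ.x₀ Δ.x₀) :
    Δ.lift (_root_.FundamentalGroup.fromPath (Path.Homotopic.Quotient.mk γ)) = Δ.pathLabel γ :=
  rfl

/-- The van Kampen homomorphism on the class of a loop inside a piece is `φ` of the class of
the loop in the piece. [folklore] -/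
theorem lift_fromPath_of_subset (P : Δ.Piece) (hP : P = Δ.pieceU ∨ P = Δ.pieceT)
    (γ : Path Δ.x₀ Δ.x₀) (hγ : ∀ t, γ t ∈ P.S) :
    Δ.lift (_root_.FundamentalGroup.fromPath (Path.Homotopic.Quotient.mk γ)) =
      P.cls (liftPath P.S γ hγ) :=
  Δ.pathLabel_loop P hP γ hγ

/-- **Restriction to `π₁(U)`**: `Φ ∘ (i_U)_* = φ_U`. [cite: HatcherAT2002, Thm. 1.20] -/
theorem lift_inclHom_U (a : _root_.FundamentalGroup Δ.U ⟨Δ.x₀, Δ.hxU⟩) :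
    Δ.lift (inclHom Δ.U Δ.x₀ Δ.hxU a) = Δ.φU a := by
  induction a using PushoutData.ind_fromPath with
  | h δ =>
    rw [inclHom_fromPath, Δ.lift_fromPath_of_subset Δ.pieceU (Or.inl rfl) _ (fun t => (δ t).2)]
    change Δ.φU _ = Δ.φU _
    congr 3

/-- **Restriction to `π₁(T)`**: `Φ ∘ (i_T)_* = φ_T`. [cite: HatcherAT2002, Thm. 1.20] -/
theorem lift_inclHom_T (a : _root_.FundamentalGroup Δ.T ⟨Δ.x₀, Δ.hxT⟩) :
    Δ.lift (inclHom Δ.T Δ.x₀ Δ.hxT a) = Δ.φT a := by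
  induction a using PushoutData.ind_fromPath with
  | h δ =>
    rw [inclHom_fromPath, Δ.lift_fromPath_of_subset Δ.pieceT (Or.inr rfl) _ (fun t => (δ t).2)]
    change Δ.φT _ = Δ.φT _
    congr 3

/-- `Φ ∘ (i_U)_* = φ_U`, as homomorphisms. [folklore] -/
theorem lift_comp_inclHom_U : Δ.lift.comp (inclHom Δ.U Δ.x₀ Δ.hxU) = Δ.φU :=
  MonoidHom.ext Δ.lift_inclHom_U

/-- `Φ ∘ (i_T)_* = φ_T`, as homomorphisms. [folklore] -/
theorem lift_comp_inclHom_T : Δ.lift.comp (inclHom Δ.T Δ.x₀ Δ.hxT) = Δ.φT :=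
  MonoidHom.ext Δ.lift_inclHom_T

/-! ### The value on the stable loop -/

/-- **The stable loop** `t = η_U · η_T⁻¹`, a loop at `x₀` through `C₂`. [folklore] -/
def stableLoop : Path Δ.x₀ Δ.x₀ := Δ.ηU.trans Δ.ηT.symm

/-- The class of the stable loop in `π₁(Y, x₀)`. [folklore] -/
def stableClass : _root_.FundamentalGroup Y Δ.x₀ :=
  _root_.FundamentalGroup.fromPath (Path.Homotopic.Quotient.mk Δ.stableLoop)

/-- The label of `η_U` is `1`: `conn_U(x₀)` is constant and `conn_U(c₂) = η_U · (const)`.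
[folklore] -/
theorem pathLabel_ηU : Δ.pathLabel Δ.ηU = 1 := by
  rw [Δ.pathLabel_eq_lab Δ.pieceU (Or.inl rfl) Δ.ηU Δ.ηU_mem, Δ.lab_eq_glab_U Δ.ηU Δ.ηU_mem]
  unfold Piece.glab
  rw [pieceU_gauge, pieceU_gauge, inv_one, one_mul, mul_one]
  have hloop : Δ.pieceU.loop Δ.ηU = (Path.refl Δ.x₀).trans (Δ.ηU.trans (Δ.ηU.trans
      (Path.refl Δ.c₂)).symm) := by
    change (Δ.connU Δ.x₀).trans (Δ.ηU.trans (Δ.connU Δ.c₂).symm) = _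
    rw [Δ.connU_self, Δ.connU_of_mem Δ.hc₂, Δ.arc_self]
  have hr0 : ∀ t, (Path.refl Δ.x₀) t ∈ Δ.U := fun _ => Δ.hxU
  have hr2 : ∀ t, (Path.refl Δ.c₂) t ∈ Δ.U := fun _ => Δ.C₂_subset_U Δ.hc₂
  have h2 : ∀ t, (Δ.ηU.trans (Path.refl Δ.c₂)) t ∈ Δ.U := trans_mem Δ.ηU_mem hr2
  have h3 : ∀ t, (Δ.ηU.trans (Δ.ηU.trans (Path.refl Δ.c₂)).symm) t ∈ Δ.U :=
    trans_mem Δ.ηU_mem (symm_mem h2)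
  have h4 : ∀ t, ((Path.refl Δ.x₀).trans (Δ.ηU.trans (Δ.ηU.trans (Path.refl Δ.c₂)).symm)) t ∈ Δ.U :=
    trans_mem hr0 h3
  rw [Δ.pieceU.plab_eq_cls_of_loop_eq Δ.ηU Δ.ηU_mem hloop h4, ← Δ.pieceU.cls_refl]
  apply Δ.pieceU.cls_eq_of_mk_eq
  change Path.Homotopic.Quotient.mk (liftPath Δ.U _ h4) =
    Path.Homotopic.Quotient.mk (Path.refl (⟨Δ.x₀, Δ.hxU⟩ : Δ.U))
  rw [liftPath_trans _ _ _ hr0 h3, liftPath_trans _ _ _ Δ.ηU_mem (symm_mem h2),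
    liftPath_symm _ _ h2, liftPath_trans _ _ _ Δ.ηU_mem hr2]
  have e0 : liftPath Δ.U (Path.refl Δ.x₀) hr0 = Path.refl _ := by ext; rfl
  have e2 : liftPath Δ.U (Path.refl Δ.c₂) hr2 = Path.refl _ := by ext; rfl
  rw [e0, e2]
  simp only [Path.Homotopic.Quotient.mk_trans, Path.Homotopic.Quotient.mk_symm,
    Path.Homotopic.Quotient.mk_refl, Path.Homotopic.Quotient.trans_refl,
    Path.Homotopic.Quotient.trans_symm]

/-- The label of `η_T⁻¹` is `τ`: the loop is trivial and the gauge at `c₂` is `τ`. [folklore] -/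
theorem pathLabel_ηT_symm : Δ.pathLabel Δ.ηT.symm = Δ.τ := by
  have hs : ∀ t, Δ.ηT.symm t ∈ Δ.T := symm_mem Δ.ηT_mem
  rw [Δ.pathLabel_eq_lab Δ.pieceT (Or.inr rfl) Δ.ηT.symm hs, Δ.lab_eq_glab_T Δ.ηT.symm hs]
  unfold Piece.glab
  rw [Δ.pieceT_gauge_of_mem Δ.hc₂, Δ.pieceT_gauge_of_not_mem Δ.x₀_not_mem_C₂, inv_one, one_mul]
  have hloop : Δ.pieceT.loop Δ.ηT.symm = (Δ.ηT.trans (Path.refl Δ.c₂)).trans (Δ.ηT.symm.trans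
      (Path.refl Δ.x₀).symm) := by
    change (Δ.connT Δ.c₂).trans (Δ.ηT.symm.trans (Δ.connT Δ.x₀).symm) = _
    rw [Δ.connT_self, Δ.connT_of_mem Δ.hc₂, Δ.arc_self]
  have hr0 : ∀ t, (Path.refl Δ.x₀) t ∈ Δ.T := fun _ => Δ.hxT
  have hr0s : ∀ t, (Path.refl Δ.x₀).symm t ∈ Δ.T := fun _ => Δ.hxT
  have hr2 : ∀ t, (Path.refl Δ.c₂) t ∈ Δ.T := fun _ => Δ.C₂_subset_T Δ.hc₂
  have h2 : ∀ t, (Δ.ηT.trans (Path.refl Δ.c₂)) t ∈ Δ.T := trans_mem Δ.ηT_mem hr2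
  have h3 : ∀ t, (Δ.ηT.symm.trans (Path.refl Δ.x₀).symm) t ∈ Δ.T := trans_mem hs hr0s
  have h4 : ∀ t, ((Δ.ηT.trans (Path.refl Δ.c₂)).trans (Δ.ηT.symm.trans (Path.refl Δ.x₀).symm)) t
      ∈ Δ.T := trans_mem h2 h3
  have hone : Δ.pieceT.plab Δ.ηT.symm hs = 1 := by
    rw [Δ.pieceT.plab_eq_cls_of_loop_eq Δ.ηT.symm hs hloop h4, ← Δ.pieceT.cls_refl]
    apply Δ.pieceT.cls_eq_of_mk_eq
    change Path.Homotopic.Quotient.mk (liftPath Δ.T _ h4) =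
      Path.Homotopic.Quotient.mk (Path.refl (⟨Δ.x₀, Δ.hxT⟩ : Δ.T))
    rw [liftPath_trans _ _ _ h2 h3, liftPath_trans _ _ _ Δ.ηT_mem hr2, liftPath_trans _ _ _ hs hr0s,
      liftPath_symm _ _ Δ.ηT_mem, liftPath_symm _ _ hr0]
    have e0 : liftPath Δ.T (Path.refl Δ.x₀) hr0 = Path.refl _ := by ext; rfl
    have e2 : liftPath Δ.T (Path.refl Δ.c₂) hr2 = Path.refl _ := by ext; rfl
    rw [e0, e2]
    simp only [Path.Homotopic.Quotient.mk_trans, Path.Homotopic.Quotient.mk_symm,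
      Path.Homotopic.Quotient.mk_refl, Path.Homotopic.Quotient.trans_refl,
      Path.Homotopic.Quotient.trans_symm, Path.refl_symm]
  rw [hone, one_mul]

/-- **The value on the stable loop**: `Φ [η_U · η_T⁻¹] = τ`. [cite: HatcherAT2002, §1.B] -/
theorem lift_stableClass : Δ.lift Δ.stableClass = Δ.τ := by
  rw [stableClass, lift_fromPath, stableLoop, Δ.pathLabel_trans, Δ.pathLabel_ηU,
    Δ.pathLabel_ηT_symm, mul_one]

/-! ### Generation -/

/-- The generators: the images of `π₁(U, x₀)`, `π₁(T, x₀)` and the class of the stable loop.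
[folklore] -/
def gens : Set (_root_.FundamentalGroup Y Δ.x₀) :=
  Set.range (inclHom Δ.U Δ.x₀ Δ.hxU) ∪ Set.range (inclHom Δ.T Δ.x₀ Δ.hxT) ∪ {Δ.stableClass}

/-- The product of the classes of the loops `conn_U · E|[tⱼ, tⱼ₊₁] · conn_U⁻¹` of the first
`k` edges of a path (reversed order). [folklore] -/
def loopProd {y y' : Y} (E : Path y y') (n k : ℕ) : _root_.FundamentalGroup Y Δ.x₀ :=
  rowProd (fun _ j => _root_.FundamentalGroup.fromPath
    (Path.Homotopic.Quotient.mk (Δ.pieceU.loop (PushoutData.edge E n j)))) 0 k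

/-- The `U`-loop of a path, unfolded. [folklore] -/
theorem pieceU_loop {y y' : Y} (E : Path y y') :
    Δ.pieceU.loop E = (Δ.connU y).trans (E.trans (Δ.connU y').symm) := rfl

/-- The `T`-loop of a path, unfolded. [folklore] -/
theorem pieceT_loop {y y' : Y} (E : Path y y') :
    Δ.pieceT.loop E = (Δ.connT y).trans (E.trans (Δ.connT y').symm) := rfl

/-- **Telescoping in `Y`**: the product of the edge loops of the first `l` edges is the class
of `conn_U · E|[0, l/n] · conn_U⁻¹`. [folklore] -/
theorem loopProd_eq {y y' : Y} (E : Path y y') (n l : ℕ) :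
    Δ.loopProd E n l = _root_.FundamentalGroup.fromPath (Path.Homotopic.Quotient.mk
      ((Δ.connU (E (gc n 0))).trans ((E.subpath (gc n 0) (gc n l)).trans
        (Δ.connU (E (gc n l))).symm))) := by
  induction l with
  | zero =>
    rw [loopProd, rowProd_zero, Path.subpath_self, _root_.FundamentalGroup.one_def]
    simp only [_root_.FundamentalGroup.fromPath, _root_.FundamentalGroup.fromArrow,
      Path.Homotopic.Quotient.mk_trans, Path.Homotopic.Quotient.mk_symm,
      Path.Homotopic.Quotient.mk_refl, Path.Homotopic.Quotient.refl_trans,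
      Path.Homotopic.Quotient.trans_symm]
  | succ l ih =>
    rw [loopProd] at ih ⊢
    rw [rowProd_succ, ih, _root_.FundamentalGroup.mul_def]
    have hS : ∀ ρ : Path.Homotopic.Quotient (E (gc n (l + 1))) Δ.x₀,
        (Path.Homotopic.Quotient.mk (E.subpath (gc n 0) (gc n l))).trans
          ((Path.Homotopic.Quotient.mk (E.subpath (gc n l) (gc n (l + 1)))).trans ρ) =
        (Path.Homotopic.Quotient.mk (E.subpath (gc n 0) (gc n (l + 1)))).trans ρ := by
      intro ρ
      rw [← Path.Homotopic.Quotient.trans_assoc, ← Path.Homotopic.Quotient.mk_trans,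
        Path.Homotopic.Quotient.eq.2 ⟨Path.Homotopy.subpathTransSubpath E _ _ _⟩]
    rw [pieceU_loop]
    simp only [_root_.FundamentalGroup.fromPath, _root_.FundamentalGroup.fromArrow,
      Path.Homotopic.Quotient.mk_trans, Path.Homotopic.Quotient.mk_symm,
      Path.Homotopic.Quotient.trans_assoc, symm_trans_cancel, hS]

/-- Conjugating by the `U`-connecting paths of end points equal to the base point does
nothing. [folklore] -/
theorem mk_connU_trans_trans_connU_symm {w w' : Y} (δ : Path w w') (hw : Δ.x₀ = w)
    (hw' : Δ.x₀ = w') :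
    Path.Homotopic.Quotient.mk ((Δ.connU w).trans (δ.trans (Δ.connU w').symm)) =
      Path.Homotopic.Quotient.mk (δ.cast hw hw') := by
  subst hw hw'
  rw [Δ.connU_self, Path.refl_symm, Path.cast_rfl_rfl]
  simp only [Path.Homotopic.Quotient.mk_trans, Path.Homotopic.Quotient.mk_refl,
    Path.Homotopic.Quotient.refl_trans, Path.Homotopic.Quotient.trans_refl]

/-- **Every loop is the product of its edge loops.** [cite: HatcherAT2002, proof of Lemma 1.15] -/
theorem loopProd_self (γ : Path Δ.x₀ Δ.x₀) {n : ℕ} (hn : 0 < n) :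
    Δ.loopProd γ n n = _root_.FundamentalGroup.fromPath (Path.Homotopic.Quotient.mk γ) := by
  rw [Δ.loopProd_eq γ n n]
  have key : ∀ (t₀ t₁ : I) (h0 : t₀ = 0) (h1 : t₁ = 1),
      Path.Homotopic.Quotient.mk ((Δ.connU (γ t₀)).trans ((γ.subpath t₀ t₁).trans
        (Δ.connU (γ t₁)).symm)) = Path.Homotopic.Quotient.mk γ := by
    intro t₀ t₁ h0 h1
    subst h0 h1
    rw [Δ.mk_connU_trans_trans_connU_symm _ γ.source.symm γ.target.symm]
    congr 1
    ext t
    rw [Path.cast_coe, Path.subpath_zero_one, Path.cast_coe]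
  exact congrArg _root_.FundamentalGroup.fromPath (key _ _ (gc_zero n) (gc_self hn))

/-- The class of `conn_U(v) · conn_T(v)⁻¹` is `1` off `C₂` and the stable class on `C₂`; in
either case it lies in the subgroup generated by the generators. [folklore] -/
theorem fromPath_connU_connT_symm_mem_closure (v : Y) :
    _root_.FundamentalGroup.fromPath (Path.Homotopic.Quotient.mk
        ((Δ.connU v).trans (Δ.connT v).symm)) ∈ Subgroup.closure Δ.gens := by
  by_cases hv : v ∈ Δ.C₂
  · have : _root_.FundamentalGroup.fromPath (Path.Homotopic.Quotient.mk
        ((Δ.connU v).trans (Δ.connT v).symm)) = Δ.stableClass := by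
      rw [Δ.connU_of_mem hv, Δ.connT_of_mem hv, Path.trans_symm]
      change _ = _root_.FundamentalGroup.fromPath (Path.Homotopic.Quotient.mk (Δ.ηU.trans Δ.ηT.symm))
      simp only [Path.Homotopic.Quotient.mk_trans, Path.Homotopic.Quotient.mk_symm,
        Path.Homotopic.Quotient.trans_assoc, trans_symm_cancel]
    rw [this]
    exact Subgroup.subset_closure (Or.inr rfl)
  · have : _root_.FundamentalGroup.fromPath (Path.Homotopic.Quotient.mk
        ((Δ.connU v).trans (Δ.connT v).symm)) = 1 := by
      rw [Δ.connU_of_not_mem hv, Δ.connT_of_not_mem hv, _root_.FundamentalGroup.one_def]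
      simp only [_root_.FundamentalGroup.fromPath, _root_.FundamentalGroup.fromArrow,
        Path.Homotopic.Quotient.mk_trans, Path.Homotopic.Quotient.mk_symm,
        Path.Homotopic.Quotient.trans_symm]
    rw [this]
    exact Subgroup.one_mem _

/-- The `U`-loop of a path is the `T`-loop conjugated by `conn_U · conn_T⁻¹` at the two ends
(in `π₁(Y, x₀)`). [folklore] -/
theorem fromPath_pieceU_loop_eq {y y' : Y} (E : Path y y') :
    _root_.FundamentalGroup.fromPath (Path.Homotopic.Quotient.mk (Δ.pieceU.loop E)) =
      (_root_.FundamentalGroup.fromPath (Path.Homotopic.Quotient.mk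
          ((Δ.connU y').trans (Δ.connT y').symm)))⁻¹ *
        _root_.FundamentalGroup.fromPath (Path.Homotopic.Quotient.mk (Δ.pieceT.loop E)) *
        _root_.FundamentalGroup.fromPath (Path.Homotopic.Quotient.mk
          ((Δ.connU y).trans (Δ.connT y).symm)) := by
  have hinv : (_root_.FundamentalGroup.fromPath (Path.Homotopic.Quotient.mk
      ((Δ.connU y').trans (Δ.connT y').symm)) : _root_.FundamentalGroup Y Δ.x₀)⁻¹ =
      _root_.FundamentalGroup.fromPath (Path.Homotopic.Quotient.mk
        ((Δ.connT y').trans (Δ.connU y').symm)) := by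
    rw [_root_.FundamentalGroup.inv_def]
    change Path.Homotopic.Quotient.symm (Path.Homotopic.Quotient.mk _) = Path.Homotopic.Quotient.mk _
    rw [← Path.Homotopic.Quotient.mk_symm, Path.trans_symm, Path.symm_symm]
  rw [hinv, pieceU_loop, pieceT_loop, _root_.FundamentalGroup.mul_def,
    _root_.FundamentalGroup.mul_def]
  simp only [_root_.FundamentalGroup.fromPath, _root_.FundamentalGroup.fromArrow,
    Path.Homotopic.Quotient.mk_trans, Path.Homotopic.Quotient.mk_symm,
    Path.Homotopic.Quotient.trans_assoc, symm_trans_cancel]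

/-- The class of the `U`-loop of an edge inside a piece is in the subgroup generated by the
generators: inside `U` it is in the image of `π₁(U)`; inside `T` it is the `T`-loop conjugated
by `conn_U · conn_T⁻¹` at the two ends. [folklore] -/
theorem fromPath_loop_mem_closure {y y' : Y} (E : Path y y')
    (hE : (∀ t, E t ∈ Δ.U) ∨ (∀ t, E t ∈ Δ.T)) :
    _root_.FundamentalGroup.fromPath (Path.Homotopic.Quotient.mk (Δ.pieceU.loop E)) ∈
      Subgroup.closure Δ.gens := by
  rcases hE with hU | hT
  · exact Subgroup.subset_closure (Or.inl (Or.inl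
      ⟨_, inclHom_fromPath_liftPath Δ.hxU (Δ.pieceU.loop E) (Δ.pieceU.loop_mem E hU)⟩))
  · have hmT : _root_.FundamentalGroup.fromPath (Path.Homotopic.Quotient.mk (Δ.pieceT.loop E)) ∈
        Subgroup.closure Δ.gens :=
      Subgroup.subset_closure (Or.inl (Or.inr
        ⟨_, inclHom_fromPath_liftPath Δ.hxT (Δ.pieceT.loop E) (Δ.pieceT.loop_mem E hT)⟩))
    rw [Δ.fromPath_pieceU_loop_eq E]
    exact Subgroup.mul_mem _ (Subgroup.mul_mem _ (Subgroup.inv_mem _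
      (Δ.fromPath_connU_connT_symm_mem_closure y')) hmT) (Δ.fromPath_connU_connT_symm_mem_closure y)

/-- **Generation** (the analogue of Hatcher's Lemma 1.15): `π₁(Y, x₀)` is generated by the
images of `π₁(U, x₀)`, `π₁(T, x₀)` and the class of the stable loop.
[cite: HatcherAT2002, Lemma 1.15 and §1.B] -/
theorem closure_gens_eq_top : Subgroup.closure Δ.gens = ⊤ := by
  rw [eq_top_iff]
  intro a _
  induction a using PushoutData.ind_fromPath with
  | h γ =>
    obtain ⟨n, hn⟩ := Δ.exists_adm γ
    rw [← Δ.loopProd_self γ hn.1]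
    have : ∀ k, k ≤ n → Δ.loopProd γ n k ∈ Subgroup.closure Δ.gens := by
      intro k
      induction k with
      | zero => intro; exact Subgroup.one_mem _
      | succ k ih =>
        intro hk
        rw [loopProd, rowProd_succ]
        exact Subgroup.mul_mem _ (Δ.fromPath_loop_mem_closure _ (hn.2 k hk))
          (ih (Nat.le_of_succ_le hk))
    exact this n le_rfl

/-- **Uniqueness half**: two homomorphisms on `π₁(Y, x₀)` that agree on the images of `π₁(U)`,
`π₁(T)` and on the stable loop are equal. [cite: HatcherAT2002, Thm. 1.20] -/
theorem hom_ext {K : Type*} [Group K] {Φ Ψ : _root_.FundamentalGroup Y Δ.x₀ →* K}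
    (hU : Φ.comp (inclHom Δ.U Δ.x₀ Δ.hxU) = Ψ.comp (inclHom Δ.U Δ.x₀ Δ.hxU))
    (hT : Φ.comp (inclHom Δ.T Δ.x₀ Δ.hxT) = Ψ.comp (inclHom Δ.T Δ.x₀ Δ.hxT))
    (ht : Φ Δ.stableClass = Ψ Δ.stableClass) : Φ = Ψ := by
  refine MonoidHom.eq_of_eqOn_dense Δ.closure_gens_eq_top ?_
  rintro _ ((⟨a, rfl⟩ | ⟨a, rfl⟩) | h)
  · exact DFunLike.congr_fun hU a
  · exact DFunLike.congr_fun hT a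
  · rw [mem_singleton_iff] at h
    rw [h]
    exact ht

/-- **The universal property (two-component Seifert–van Kampen theorem).** The van Kampen
homomorphism is the unique homomorphism `π₁(Y, x₀) → G` restricting to `φ_U` on `π₁(U)`, to
`φ_T` on `π₁(T)`, and taking the value `τ` on the stable loop. [cite: HatcherAT2002, Thm. 1.20 and §1.B] -/
theorem lift_unique (Φ : _root_.FundamentalGroup Y Δ.x₀ →* G)
    (hU : Φ.comp (inclHom Δ.U Δ.x₀ Δ.hxU) = Δ.φU) (hT : Φ.comp (inclHom Δ.T Δ.x₀ Δ.hxT) = Δ.φT)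
    (ht : Φ Δ.stableClass = Δ.τ) : Φ = Δ.lift :=
  Δ.hom_ext (hU.trans Δ.lift_comp_inclHom_U.symm) (hT.trans Δ.lift_comp_inclHom_T.symm)
    (ht.trans Δ.lift_stableClass.symm)

/-- **Existence and uniqueness** in one statement. [cite: HatcherAT2002, Thm. 1.20 and §1.B] -/
theorem existsUnique_hom :
    ∃! Φ : _root_.FundamentalGroup Y Δ.x₀ →* G,
      Φ.comp (inclHom Δ.U Δ.x₀ Δ.hxU) = Δ.φU ∧ Φ.comp (inclHom Δ.T Δ.x₀ Δ.hxT) = Δ.φT ∧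
        Φ Δ.stableClass = Δ.τ :=
  ⟨Δ.lift, ⟨Δ.lift_comp_inclHom_U, Δ.lift_comp_inclHom_T, Δ.lift_stableClass⟩,
    fun Φ h => Δ.lift_unique Φ h.1 h.2.1 h.2.2⟩

end HNNData

/-! ### Simply connected `T`, `C₁`, `C₂`: the free product with `ℤ` -/

section CoprodInt

variable {U T C₁ C₂ : Set Y} {x₀ c₂ : Y}

omit [Group G] in
/-- A loop inside a simply connected subset `C` has trivial class in `π₁(S)` for every `S ⊇ C`.
[folklore] -/
theorem fromPath_liftPath_eq_one_of_subset {C S : Set Y} (hsc : IsSimplyConnected C)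
    (hCS : C ⊆ S) {x : Y} (hxS : x ∈ S) (δ : Path x x) (hδC : ∀ t, δ t ∈ C)
    (hδS : ∀ t, δ t ∈ S) :
    (_root_.FundamentalGroup.fromPath (Path.Homotopic.Quotient.mk (liftPath S δ hδS)) :
      _root_.FundamentalGroup S ⟨x, hxS⟩) = 1 := by
  obtain ⟨-, h⟩ := isSimplyConnected_iff_exists_homotopy_refl_forall_mem.1 hsc
  obtain ⟨F, hF⟩ := h x δ hδC
  have hw : HomotopicWithin S δ (Path.refl x) := ⟨F, fun t => hCS (hF t)⟩
  have hl : (liftPath S δ hδS).Homotopic (liftPath S (Path.refl x) fun _ => hxS) :=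
    hw.liftPath hδS fun _ => hxS
  have hrefl : liftPath S (Path.refl x) (fun _ => hxS) = Path.refl (⟨x, hxS⟩ : S) := by
    ext t
    rfl
  rw [_root_.FundamentalGroup.one_def, ← Path.Homotopic.Quotient.mk_refl, ← hrefl]
  exact congrArg _root_.FundamentalGroup.fromPath (Path.Homotopic.Quotient.eq.2 hl)

omit [Group G] in
/-- A loop `η · δ · η⁻¹` with `δ` inside a simply connected `C ⊆ S` and `η ⊆ S` has trivial
class in `π₁(S)`. [folklore] -/
theorem fromPath_liftPath_conj_eq_one_of_subset {C S : Set Y} (hsc : IsSimplyConnected C)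
    (hCS : C ⊆ S) {x c : Y} (hxS : x ∈ S) (η : Path x c) (hη : ∀ t, η t ∈ S) (δ : Path c c)
    (hδC : ∀ t, δ t ∈ C) (h : ∀ t, (η.trans (δ.trans η.symm)) t ∈ S) :
    (_root_.FundamentalGroup.fromPath (Path.Homotopic.Quotient.mk (liftPath S _ h)) :
      _root_.FundamentalGroup S ⟨x, hxS⟩) = 1 := by
  have hδS : ∀ t, δ t ∈ S := fun t => hCS (hδC t)
  have hcS : c ∈ S := η.target ▸ hη 1
  have hηs : ∀ t, η.symm t ∈ S := symm_mem hη
  have h1 := fromPath_liftPath_eq_one_of_subset hsc hCS hcS δ hδC hδS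
  rw [_root_.FundamentalGroup.one_def] at h1 ⊢
  rw [liftPath_trans S _ _ hη (trans_mem hδS hηs), liftPath_trans S _ _ hδS hηs,
    liftPath_symm S _ hη]
  change Path.Homotopic.Quotient.mk _ = _
  change Path.Homotopic.Quotient.mk _ = _ at h1
  simp only [Path.Homotopic.Quotient.mk_trans, Path.Homotopic.Quotient.mk_symm, h1,
    Path.Homotopic.Quotient.refl_trans, Path.Homotopic.Quotient.trans_symm]

/-- **The datum of the free product with `ℤ`**: `G = π₁(U, x₀) ∗ ℤ`, `φ_U = inl`, `φ_T = 1`,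
`τ = inr 1`; conditions (1), (2) hold because loops inside the simply connected `C₁`, `C₂` are
trivial in `π₁(U)`. [folklore] -/
def HNNData.coprodInt (hUo : IsOpen U) (hTo : IsOpen T) (hcov : U ∪ T = univ)
    (hC₁o : IsOpen C₁) (hC₂o : IsOpen C₂) (hdisj : Disjoint C₁ C₂) (hinter : U ∩ T = C₁ ∪ C₂)
    (hx₀ : x₀ ∈ C₁) (hxU : x₀ ∈ U) (hxT : x₀ ∈ T) (hc₂ : c₂ ∈ C₂) (hUpc : IsPathConnected U)
    (hTpc : IsPathConnected T) (h₁ : IsSimplyConnected C₁) (h₂ : IsSimplyConnected C₂)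
    (ηU : Path x₀ c₂) (hηU : ∀ t, ηU t ∈ U) (ηT : Path x₀ c₂) (hηT : ∀ t, ηT t ∈ T) :
    HNNData Y (Monoid.Coprod (_root_.FundamentalGroup U ⟨x₀, hxU⟩) (Multiplicative ℤ)) where
  U := U
  T := T
  hUo := hUo
  hTo := hTo
  hcov := hcov
  C₁ := C₁
  C₂ := C₂
  hC₁o := hC₁o
  hC₂o := hC₂o
  hdisj := hdisj
  hinter := hinter
  x₀ := x₀
  hx₀ := hx₀
  hxU := hxU
  hxT := hxT
  c₂ := c₂
  hc₂ := hc₂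
  hUpc := hUpc
  hTpc := hTpc
  hC₁pc := h₁.isPathConnected
  hC₂pc := h₂.isPathConnected
  ηU := ηU
  ηU_mem := hηU
  ηT := ηT
  ηT_mem := hηT
  φU := Monoid.Coprod.inl
  φT := 1
  τ := Monoid.Coprod.inr (Multiplicative.ofAdd 1)
  compat₁ δ hU hT hC := by
    have hCU : C₁ ⊆ U := fun _ h => (hinter.symm.subset (Or.inl h)).1
    rw [fromPath_liftPath_eq_one_of_subset h₁ hCU hxU δ hC hU, map_one, MonoidHom.one_apply]
  compat₂ δ hC hU hT := by
    have hCU : C₂ ⊆ U := fun _ h => (hinter.symm.subset (Or.inr h)).1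
    rw [fromPath_liftPath_conj_eq_one_of_subset h₂ hCU hxU ηU hηU δ hC hU, map_one,
      MonoidHom.one_apply, mul_one, inv_mul_cancel]

/-- The class of the stable loop of the datum `coprodInt` is that of `η_U · η_T⁻¹`. [folklore] -/
theorem HNNData.coprodInt_stableClass (hUo : IsOpen U) (hTo : IsOpen T) (hcov : U ∪ T = univ)
    (hC₁o : IsOpen C₁) (hC₂o : IsOpen C₂) (hdisj : Disjoint C₁ C₂) (hinter : U ∩ T = C₁ ∪ C₂)
    (hx₀ : x₀ ∈ C₁) (hxU : x₀ ∈ U) (hxT : x₀ ∈ T) (hc₂ : c₂ ∈ C₂) (hUpc : IsPathConnected U)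
    (hTpc : IsPathConnected T) (h₁ : IsSimplyConnected C₁) (h₂ : IsSimplyConnected C₂)
    (ηU : Path x₀ c₂) (hηU : ∀ t, ηU t ∈ U) (ηT : Path x₀ c₂) (hηT : ∀ t, ηT t ∈ T) :
    (HNNData.coprodInt hUo hTo hcov hC₁o hC₂o hdisj hinter hx₀ hxU hxT hc₂ hUpc hTpc h₁ h₂ ηU hηU
      ηT hηT).stableClass =
      _root_.FundamentalGroup.fromPath (Path.Homotopic.Quotient.mk (ηU.trans ηT.symm)) :=
  rfl

/-- `(i_U)_* ∗ (n ↦ tⁿ)` is a left inverse of the van Kampen homomorphism of the datum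
`coprodInt` when `T` is simply connected (uniqueness half). [folklore] -/
theorem coprodIntLift_comp_lift (hUo : IsOpen U) (hTo : IsOpen T) (hcov : U ∪ T = univ)
    (hC₁o : IsOpen C₁) (hC₂o : IsOpen C₂) (hdisj : Disjoint C₁ C₂) (hinter : U ∩ T = C₁ ∪ C₂)
    (hx₀ : x₀ ∈ C₁) (hxU : x₀ ∈ U) (hxT : x₀ ∈ T) (hc₂ : c₂ ∈ C₂) (hUpc : IsPathConnected U)
    (hTsc : IsSimplyConnected T) (h₁ : IsSimplyConnected C₁) (h₂ : IsSimplyConnected C₂)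
    (ηU : Path x₀ c₂) (hηU : ∀ t, ηU t ∈ U) (ηT : Path x₀ c₂) (hηT : ∀ t, ηT t ∈ T) :
    (Monoid.Coprod.lift (inclHom U x₀ hxU) (zpowersHom _ (_root_.FundamentalGroup.fromPath
        (Path.Homotopic.Quotient.mk (ηU.trans ηT.symm))))).comp
      (HNNData.coprodInt hUo hTo hcov hC₁o hC₂o hdisj hinter hx₀ hxU hxT hc₂ hUpc
        hTsc.isPathConnected h₁ h₂ ηU hηU ηT hηT).lift =
      MonoidHom.id (_root_.FundamentalGroup Y x₀) := by
  set D := HNNData.coprodInt hUo hTo hcov hC₁o hC₂o hdisj hinter hx₀ hxU hxT hc₂ hUpc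
    hTsc.isPathConnected h₁ h₂ ηU hηU ηT hηT with hD
  haveI : SimplyConnectedSpace D.T := hTsc.simplyConnectedSpace
  refine D.hom_ext ?_ ?_ ?_
  · ext a
    change Monoid.Coprod.lift (inclHom U x₀ hxU) (zpowersHom _ (_root_.FundamentalGroup.fromPath
        (Path.Homotopic.Quotient.mk (ηU.trans ηT.symm)))) (D.lift (inclHom U x₀ hxU a)) =
      inclHom U x₀ hxU a
    rw [show D.lift (inclHom U x₀ hxU a) = Monoid.Coprod.inl a from D.lift_inclHom_U a]
    exact Monoid.Coprod.lift_apply_inl _ _ a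
  · ext a
    have ha : a = 1 := by
      induction a using PushoutData.ind_fromPath with
      | h δ =>
        rw [_root_.FundamentalGroup.one_def, ← Path.Homotopic.Quotient.mk_refl]
        exact congrArg _root_.FundamentalGroup.fromPath
          (Path.Homotopic.Quotient.eq.2 (SimplyConnectedSpace.paths_homotopic _ _))
    rw [ha, map_one, map_one]
  · change Monoid.Coprod.lift (inclHom U x₀ hxU) (zpowersHom _ (_root_.FundamentalGroup.fromPath
        (Path.Homotopic.Quotient.mk (ηU.trans ηT.symm)))) (D.lift D.stableClass) = D.stableClass
    rw [D.lift_stableClass]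
    change Monoid.Coprod.lift (inclHom U x₀ hxU) (zpowersHom _ (_root_.FundamentalGroup.fromPath
        (Path.Homotopic.Quotient.mk (ηU.trans ηT.symm)))) (Monoid.Coprod.inr (Multiplicative.ofAdd 1)) = _
    rw [Monoid.Coprod.lift_apply_inr, zpowersHom_apply, toAdd_ofAdd, zpow_one]
    rfl

/-- `(i_U)_* ∗ (n ↦ tⁿ)` is a right inverse of the van Kampen homomorphism of the datum
`coprodInt` (restriction properties). [folklore] -/
theorem lift_comp_coprodIntLift (hUo : IsOpen U) (hTo : IsOpen T) (hcov : U ∪ T = univ)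
    (hC₁o : IsOpen C₁) (hC₂o : IsOpen C₂) (hdisj : Disjoint C₁ C₂) (hinter : U ∩ T = C₁ ∪ C₂)
    (hx₀ : x₀ ∈ C₁) (hxU : x₀ ∈ U) (hxT : x₀ ∈ T) (hc₂ : c₂ ∈ C₂) (hUpc : IsPathConnected U)
    (hTpc : IsPathConnected T) (h₁ : IsSimplyConnected C₁) (h₂ : IsSimplyConnected C₂)
    (ηU : Path x₀ c₂) (hηU : ∀ t, ηU t ∈ U) (ηT : Path x₀ c₂) (hηT : ∀ t, ηT t ∈ T) :
    (HNNData.coprodInt hUo hTo hcov hC₁o hC₂o hdisj hinter hx₀ hxU hxT hc₂ hUpc hTpc h₁ h₂ ηU hηU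
        ηT hηT).lift.comp
      (Monoid.Coprod.lift (inclHom U x₀ hxU) (zpowersHom _ (_root_.FundamentalGroup.fromPath
        (Path.Homotopic.Quotient.mk (ηU.trans ηT.symm))))) = MonoidHom.id _ := by
  set D := HNNData.coprodInt hUo hTo hcov hC₁o hC₂o hdisj hinter hx₀ hxU hxT hc₂ hUpc hTpc h₁ h₂
    ηU hηU ηT hηT with hD
  refine Monoid.Coprod.hom_ext (MonoidHom.ext fun a => ?_) (MonoidHom.ext_mint ?_)
  · change D.lift (Monoid.Coprod.lift (inclHom U x₀ hxU) (zpowersHom _ (_root_.FundamentalGroup.fromPath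
        (Path.Homotopic.Quotient.mk (ηU.trans ηT.symm)))) (Monoid.Coprod.inl a)) =
      Monoid.Coprod.inl a
    rw [Monoid.Coprod.lift_apply_inl]
    exact D.lift_inclHom_U a
  · change D.lift (Monoid.Coprod.lift (inclHom U x₀ hxU) (zpowersHom _ (_root_.FundamentalGroup.fromPath
        (Path.Homotopic.Quotient.mk (ηU.trans ηT.symm))))
      (Monoid.Coprod.inr (Multiplicative.ofAdd 1))) = Monoid.Coprod.inr (Multiplicative.ofAdd 1)
    rw [Monoid.Coprod.lift_apply_inr, zpowersHom_apply, toAdd_ofAdd, zpow_one]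
    exact D.lift_stableClass

/-- **Seifert–van Kampen, two-component form with simply connected `T`, `C₁`, `C₂`: the free
product with `ℤ`.** Let `Y = U ∪ T` with `U`, `T` open and path connected,
`U ∩ T = C₁ ⊔ C₂` with `C₁`, `C₂` open, disjoint and simply connected, and `T` simply
connected; let `x₀ ∈ C₁`, `c₂ ∈ C₂` and `η_U ⊆ U`, `η_T ⊆ T` paths from `x₀` to `c₂`.  Then
`π₁(Y, x₀) ≅ π₁(U, x₀) ∗ ℤ`, the isomorphism being `(i_U)_*` on `π₁(U)` and sending the stable
loop `η_U · η_T⁻¹` to the generator of `ℤ` — e.g. for a manifold `M`, a non-separating sphere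
`S ⊆ M` with product neighbourhood `T ≅ S × (-1, 1)` simply connected, `U = M ∖ S`:
`π₁(M) ≅ π₁(M ∖ S) ∗ ℤ` (Hempel (1976), Lemma 3.8 with p. 26). [cite: HatcherAT2002, Thm. 1.20 and §1.B] -/
def fundamentalGroupEquivCoprodInt (hUo : IsOpen U) (hTo : IsOpen T) (hcov : U ∪ T = univ)
    (hC₁o : IsOpen C₁) (hC₂o : IsOpen C₂) (hdisj : Disjoint C₁ C₂) (hinter : U ∩ T = C₁ ∪ C₂)
    (hx₀ : x₀ ∈ C₁) (hxU : x₀ ∈ U) (hxT : x₀ ∈ T) (hc₂ : c₂ ∈ C₂) (hUpc : IsPathConnected U)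
    (hTsc : IsSimplyConnected T) (h₁ : IsSimplyConnected C₁) (h₂ : IsSimplyConnected C₂)
    (ηU : Path x₀ c₂) (hηU : ∀ t, ηU t ∈ U) (ηT : Path x₀ c₂) (hηT : ∀ t, ηT t ∈ T) :
    _root_.FundamentalGroup Y x₀ ≃*
      Monoid.Coprod (_root_.FundamentalGroup U ⟨x₀, hxU⟩) (Multiplicative ℤ) :=
  MonoidHom.toMulEquiv
    (HNNData.coprodInt hUo hTo hcov hC₁o hC₂o hdisj hinter hx₀ hxU hxT hc₂ hUpc
      hTsc.isPathConnected h₁ h₂ ηU hηU ηT hηT).lift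
    (Monoid.Coprod.lift (inclHom U x₀ hxU) (zpowersHom _ (_root_.FundamentalGroup.fromPath
        (Path.Homotopic.Quotient.mk (ηU.trans ηT.symm)))))
    (coprodIntLift_comp_lift hUo hTo hcov hC₁o hC₂o hdisj hinter hx₀ hxU hxT hc₂ hUpc hTsc h₁ h₂
      ηU hηU ηT hηT)
    (lift_comp_coprodIntLift hUo hTo hcov hC₁o hC₂o hdisj hinter hx₀ hxU hxT hc₂ hUpc
      hTsc.isPathConnected h₁ h₂ ηU hηU ηT hηT)

/-- The isomorphism sends the class of a loop in `U` to the left factor. [folklore] -/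
@[simp]
theorem fundamentalGroupEquivCoprodInt_inclHom (hUo : IsOpen U) (hTo : IsOpen T)
    (hcov : U ∪ T = univ) (hC₁o : IsOpen C₁) (hC₂o : IsOpen C₂) (hdisj : Disjoint C₁ C₂)
    (hinter : U ∩ T = C₁ ∪ C₂) (hx₀ : x₀ ∈ C₁) (hxU : x₀ ∈ U) (hxT : x₀ ∈ T) (hc₂ : c₂ ∈ C₂)
    (hUpc : IsPathConnected U) (hTsc : IsSimplyConnected T) (h₁ : IsSimplyConnected C₁)
    (h₂ : IsSimplyConnected C₂) (ηU : Path x₀ c₂) (hηU : ∀ t, ηU t ∈ U) (ηT : Path x₀ c₂)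
    (hηT : ∀ t, ηT t ∈ T) (a : _root_.FundamentalGroup U ⟨x₀, hxU⟩) :
    fundamentalGroupEquivCoprodInt hUo hTo hcov hC₁o hC₂o hdisj hinter hx₀ hxU hxT hc₂ hUpc hTsc
      h₁ h₂ ηU hηU ηT hηT (inclHom U x₀ hxU a) = Monoid.Coprod.inl a :=
  (HNNData.coprodInt hUo hTo hcov hC₁o hC₂o hdisj hinter hx₀ hxU hxT hc₂ hUpc hTsc.isPathConnected
    h₁ h₂ ηU hηU ηT hηT).lift_inclHom_U a

/-- The isomorphism sends the class of the stable loop `η_U · η_T⁻¹` to the generator of `ℤ`.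
[folklore] -/
@[simp]
theorem fundamentalGroupEquivCoprodInt_stableLoop (hUo : IsOpen U) (hTo : IsOpen T)
    (hcov : U ∪ T = univ) (hC₁o : IsOpen C₁) (hC₂o : IsOpen C₂) (hdisj : Disjoint C₁ C₂)
    (hinter : U ∩ T = C₁ ∪ C₂) (hx₀ : x₀ ∈ C₁) (hxU : x₀ ∈ U) (hxT : x₀ ∈ T) (hc₂ : c₂ ∈ C₂)
    (hUpc : IsPathConnected U) (hTsc : IsSimplyConnected T) (h₁ : IsSimplyConnected C₁)
    (h₂ : IsSimplyConnected C₂) (ηU : Path x₀ c₂) (hηU : ∀ t, ηU t ∈ U) (ηT : Path x₀ c₂)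
    (hηT : ∀ t, ηT t ∈ T) :
    fundamentalGroupEquivCoprodInt hUo hTo hcov hC₁o hC₂o hdisj hinter hx₀ hxU hxT hc₂ hUpc hTsc
      h₁ h₂ ηU hηU ηT hηT (_root_.FundamentalGroup.fromPath
        (Path.Homotopic.Quotient.mk (ηU.trans ηT.symm))) =
      Monoid.Coprod.inr (Multiplicative.ofAdd 1) :=
  (HNNData.coprodInt hUo hTo hcov hC₁o hC₂o hdisj hinter hx₀ hxU hxT hc₂ hUpc hTsc.isPathConnected
    h₁ h₂ ηU hηU ηT hηT).lift_stableClass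

/-- The inverse of the isomorphism on the left factor is `(i_U)_*`. [folklore] -/
@[simp]
theorem fundamentalGroupEquivCoprodInt_symm_inl (hUo : IsOpen U) (hTo : IsOpen T)
    (hcov : U ∪ T = univ) (hC₁o : IsOpen C₁) (hC₂o : IsOpen C₂) (hdisj : Disjoint C₁ C₂)
    (hinter : U ∩ T = C₁ ∪ C₂) (hx₀ : x₀ ∈ C₁) (hxU : x₀ ∈ U) (hxT : x₀ ∈ T) (hc₂ : c₂ ∈ C₂)
    (hUpc : IsPathConnected U) (hTsc : IsSimplyConnected T) (h₁ : IsSimplyConnected C₁)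
    (h₂ : IsSimplyConnected C₂) (ηU : Path x₀ c₂) (hηU : ∀ t, ηU t ∈ U) (ηT : Path x₀ c₂)
    (hηT : ∀ t, ηT t ∈ T) (a : _root_.FundamentalGroup U ⟨x₀, hxU⟩) :
    (fundamentalGroupEquivCoprodInt hUo hTo hcov hC₁o hC₂o hdisj hinter hx₀ hxU hxT hc₂ hUpc hTsc
      h₁ h₂ ηU hηU ηT hηT).symm (Monoid.Coprod.inl a) = inclHom U x₀ hxU a :=
  Monoid.Coprod.lift_apply_inl (inclHom U x₀ hxU) (zpowersHom _ (_root_.FundamentalGroup.fromPath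
    (Path.Homotopic.Quotient.mk (ηU.trans ηT.symm)))) a

/-- The inverse of the isomorphism on the second factor: `tⁿ`, `t` the class of the stable loop.
[folklore] -/
@[simp]
theorem fundamentalGroupEquivCoprodInt_symm_inr (hUo : IsOpen U) (hTo : IsOpen T)
    (hcov : U ∪ T = univ) (hC₁o : IsOpen C₁) (hC₂o : IsOpen C₂) (hdisj : Disjoint C₁ C₂)
    (hinter : U ∩ T = C₁ ∪ C₂) (hx₀ : x₀ ∈ C₁) (hxU : x₀ ∈ U) (hxT : x₀ ∈ T) (hc₂ : c₂ ∈ C₂)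
    (hUpc : IsPathConnected U) (hTsc : IsSimplyConnected T) (h₁ : IsSimplyConnected C₁)
    (h₂ : IsSimplyConnected C₂) (ηU : Path x₀ c₂) (hηU : ∀ t, ηU t ∈ U) (ηT : Path x₀ c₂)
    (hηT : ∀ t, ηT t ∈ T) (z : Multiplicative ℤ) :
    (fundamentalGroupEquivCoprodInt hUo hTo hcov hC₁o hC₂o hdisj hinter hx₀ hxU hxT hc₂ hUpc hTsc
      h₁ h₂ ηU hηU ηT hηT).symm (Monoid.Coprod.inr z) =
      _root_.FundamentalGroup.fromPath (Path.Homotopic.Quotient.mk (ηU.trans ηT.symm)) ^ z.toAdd :=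
  (Monoid.Coprod.lift_apply_inr (inclHom U x₀ hxU) (zpowersHom _ (_root_.FundamentalGroup.fromPath
    (Path.Homotopic.Quotient.mk (ηU.trans ηT.symm)))) z).trans (zpowersHom_apply _ _ z)

end CoprodInt

end VanKampen

end Literature.AlgebraicTopology.FundamentalGroup
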